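import Literature.Topology.FourManifolds.BandTransport
import Literature.Topology.FourManifolds.BandSumJunction
import HarnessLib

/-!
# Band sums at the attaching points, II: planar coordinates and the flat graph germ at `p`

Fact seat `provefact-Literature.Topology.FourManifolds.BandData.isIsotopic_of_band_eq`; second half
of the local analysis at the attaching point `p = band (0, -δ)` begun in `BandSumJunction.lean`,
towards the corrected geometric heart `BandData.exists_ambientIsotopy_of_band_eq_of_isRegular`
(`BandSumIsotopyRegular.lean`, § "Plan of the proof"). Everything here is proved; no named facts
are introduced. Throughout, `b : BandData K₁ K₂ K avoid` and `T : PatchThickening b.band δ₀ δ₁` is a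
thickening of the band over a collar wider than `b.δ < δ₁` (`BandThickening.lean`,
`BandTransport.lean`; regular band data have one, `IsRegular.exists_patchThickening`).

* `PatchThickening.planar`, `PatchThickening.height` (§ coordinates): the planar coordinate
  `param (chart c)₁₂ ∈ ℝ²` and the height `(chart c)₃` of a point `c` of the image of the thickening,
  so that `c = emb (param⁻¹ (planar c), height c)`, `planar (band x) = x`, `height (band x) = 0`
  on `range param` (`planar_apply_patch`, `height_apply_patch`); the band is injective on
  `range param ⊇ closedSquare δ` (`injOn_patch`, `BandData.injOn_band_closedSquare`); smoothness of
  the coordinates along smooth curves and regularity of chart tracks of knots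
  (`deriv_chart_track_ne_zero`: knot immersed, `circlePt` étale, chart a diffeomorphism).
* `PatchThickening.deriv_chart_track_eq_smul` (§ transfer): a velocity relation
  `(K.curve)' a = μ • (K'.curve)' a'` at a common point passes to the chart tracks
  `chart ∘ K ∘ circlePt` (the differential of `𝕊³ ⊆ ℝ⁴` is injective).
* The track of `K₁` over the window `[χ 0, χ 1]` of the left edge has planar coordinate on the
  edge line `x₀ = 0`, height `0` (`left_track_of_mem_Icc`); hence at `χ 0` the `x₀`-coordinate and
  the height have derivative `0` and — the chart track being regular — **the `x₁`-coordinate has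
  positive derivative** (`deriv_planar_left_track_one_pos`).
* `BandData.deriv_planar_track_one_pos`: by part I (`exists_pos_deriv_curve_eq_smul_left`) and the
  transfer, **the `x₁`-coordinate of the track of `K` has positive derivative at `φ 0`**; so just
  before `p` the knot `K` (there on `K₁`, off the band) **projects strictly below the edge line
  `x₁ = -δ`**: germ form `eventually_planar_track_one_lt` and set form
  `exists_radius_planar_one_lt` (all points of `K` near `p` off the band surface, `≠ p`).
* `BandData.eventually_exists_apply_eq_left`: pointwise form of "just before `p`, `K` runs on `K₁`
  just before `p`" (`K (circlePt t) = K₁ (circlePt u)`, `u ∈ (χ 0 - κ, χ 0)`).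
* `exists_openPartialHomeomorph_of_deriv_pos`, `PatchThickening.exists_track_graph` (inverse
  function theorem in one variable): near a parameter where the `x₁`-coordinate of a track has
  positive derivative, the track is a graph `x₀ = F (x₁)` with `F` smooth.
* `BandData.exists_graphFun_left` — **the difference trick**: with `F`, `F₁` the graph functions of
  the tracks of `K` and `K₁` at `p`, `d = F - F₁` is smooth near `-δ`, vanishes for `x₁ ≤ -δ` (both
  tracks run on the common arc `C⁻`) and equals `F` for `x₁ ≥ -δ` (`K₁` runs up the edge line, so
  `F₁ = 0`): the lower arc leaves `p` as the graph of a function all of whose derivatives vanish at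
  `-δ`, without any computation of jets.
* `BandData.exists_flat_graph_lowerArc_left` (main): **near `A = (0, -δ)` the planar lower arc
  `lowerArc '' [0, 1]` is the graph `{x₀ = f (x₁), x₁ ≥ -δ}` of a `C^∞` function `f : ℝ → ℝ`
  vanishing on `(-∞, -δ]`.** This, with `exists_radius_planar_one_lt`, is the local input at `A`
  for the planar isotopy of the two arc systems; the other three attaching points follow by the
  symmetries of band data (sequel).

## References

* P. R. Cromwell, *Knots and Links* (2004), §4.6 (product of oriented knots along a rectangle
  `R`; the arcs of the factors enter and leave `R` through its corners). [Cromwell2004]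
* M. W. Hirsch, *Differential Topology* (1976), Ch. 1 §3 and Ch. 4 §5, as used through
  `KnotArcLift.lean`, `BandThickening.lean`. [HirschDT1976]

## Design notes

* Hypotheses are threaded explicitly: `hδ₁ : b.δ < δ₁` (the thickening covers the closed collar),
  `Disjoint (range K₁) (range K₂)` (the tree's fact `Knot.IsBandSum.disjoint_range`); knot-level
  lemmas not involving `T` take `InjOn band (closedSquare δ)` as in part I.
* Statements about the other knot of a velocity comparison are made at literally equal base points
  through small `p = p'` helpers, avoiding rewriting inside tangent-space types.
* Local notation `𝔼 n`, `𝕊 n` follows the directory pattern. Nothing here uses `sorry`.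
-/

open scoped Manifold ContDiff Topology Real RealInnerProductSpace
open Function Set Metric Filter

noncomputable section

namespace Literature.Topology.FourManifolds

/-- Local notation: `𝔼 n` is the model Euclidean space `EuclideanSpace ℝ (Fin n)`. -/
local notation "𝔼 " n:arg => EuclideanSpace ℝ (Fin n)

/-- Local notation: `𝕊 n` is the unit sphere in `EuclideanSpace ℝ (Fin (n + 1))`. -/
local notation "𝕊 " n:arg => (Metric.sphere (0 : EuclideanSpace ℝ (Fin (n + 1))) 1)

/-! ## Planar and height coordinates of a thickening -/

namespace PatchThickening

variable {β : 𝔼 2 → 𝕊 3} {δ₀ δ₁ : ℝ} (T : PatchThickening β δ₀ δ₁)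

/-- `emb` is injective. [folklore] -/
theorem injective_emb : Injective T.emb :=
  T.isSmoothEmbedding.isEmbedding.injective

/-- The chart inverts the thickening: `chart (emb v) = v`. [folklore] -/
@[simp]
theorem chart_emb (v : 𝔼 3) : T.chart (T.emb v) = v := by
  have hv : T.emb v ∈ T.chart.source := by rw [chart_source]; exact mem_range_self v
  have := T.chart.left_inv hv
  rw [coe_chart_symm] at this
  exact T.injective_emb this

/-- The thickening inverts the chart on its image: `emb (chart c) = c` for `c ∈ range emb`.
[folklore] -/
theorem emb_chart {c : 𝕊 3} (hc : c ∈ range T.emb) : T.emb (T.chart c) = c := by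
  obtain ⟨v, rfl⟩ := hc
  rw [chart_emb]

/-- The smooth map `ℝ³ → ℝ²`, `w ↦ param (first two coordinates of w)`, reading the planar
coordinate in the model space of the chart. [folklore] -/
def slabPlanar (w : 𝔼 3) : 𝔼 2 := T.param (slabEquiv w).1

/-- `slabPlanar` is smooth. [folklore] -/
theorem contDiff_slabPlanar : ContDiff ℝ ∞ T.slabPlanar :=
  T.contDiff_param.comp (contDiff_fst.comp slabEquiv.contDiff)

/-- The **planar coordinate** of a point of `𝕊³` with respect to the thickening: the point of the
parameter plane of the band over which it lies (`param` of the first two slab coordinates of its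
chart value; meaningful on `range emb`). [folklore] -/
def planar (c : 𝕊 3) : 𝔼 2 := T.slabPlanar (T.chart c)

/-- The **height coordinate** of a point of `𝕊³` with respect to the thickening (the last slab
coordinate of its chart value; meaningful on `range emb`). [folklore] -/
def height (c : 𝕊 3) : 𝔼 1 := (slabEquiv (T.chart c)).2

/-- Unfolding of `planar`. [folklore] -/
theorem planar_def (c : 𝕊 3) : T.planar c = T.param (slabEquiv (T.chart c)).1 := rfl

/-- Unfolding of `height`. [folklore] -/
theorem height_def (c : 𝕊 3) : T.height c = (slabEquiv (T.chart c)).2 := rfl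

/-- Planar coordinate of `emb (y, z)`. [folklore] -/
@[simp]
theorem planar_emb (y : 𝔼 2) (z : 𝔼 1) : T.planar (T.emb (slabEquiv.symm (y, z))) = T.param y := by
  simp [planar, slabPlanar]

/-- Height coordinate of `emb (y, z)`. [folklore] -/
@[simp]
theorem height_emb (y : 𝔼 2) (z : 𝔼 1) : T.height (T.emb (slabEquiv.symm (y, z))) = z := by
  simp [height]

/-- A point of the image of the thickening is `emb` of its coordinates. [folklore] -/
theorem emb_symm_coords {c : 𝕊 3} (hc : c ∈ range T.emb) :
    T.emb (slabEquiv.symm ((slabEquiv (T.chart c)).1, T.height c)) = c := by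
  rw [height_def, Prod.mk.eta, ContinuousLinearEquiv.symm_apply_apply, T.emb_chart hc]

/-- A point of the image of the thickening is `emb (paramInv (planar c), height c)`. [folklore] -/
theorem emb_paramInv_planar {c : 𝕊 3} (hc : c ∈ range T.emb) :
    T.emb (slabEquiv.symm (T.paramInv (T.planar c), T.height c)) = c := by
  rw [planar_def, paramInv_param, T.emb_symm_coords hc]

/-- Points of the patch over the image of the parametrisation lie in the image of the
thickening. [folklore] -/
theorem apply_mem_range_emb {x : 𝔼 2} (hx : x ∈ range T.param) : β x ∈ range T.emb := by
  obtain ⟨y, rfl⟩ := hx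
  exact ⟨_, T.emb_inl y⟩

/-- **On the patch the planar coordinate is the parameter**: `planar (β x) = x` for
`x ∈ range param`. [folklore] -/
theorem planar_apply_patch {x : 𝔼 2} (hx : x ∈ range T.param) : T.planar (β x) = x := by
  obtain ⟨y, rfl⟩ := hx
  rw [← T.emb_inl, planar_emb]

/-- **On the patch the height vanishes**: `height (β x) = 0` for `x ∈ range param`. [folklore] -/
theorem height_apply_patch {x : 𝔼 2} (hx : x ∈ range T.param) : T.height (β x) = 0 := by
  obtain ⟨y, rfl⟩ := hx
  rw [← T.emb_inl, height_emb]

/-- A point of the image of the thickening with height `0` is the patch point over its planar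
coordinate. [folklore] -/
theorem eq_apply_planar_of_height_eq_zero {c : 𝕊 3} (hc : c ∈ range T.emb) (h0 : T.height c = 0) :
    c = β (T.planar c) := by
  conv_lhs => rw [← T.emb_paramInv_planar hc, h0, T.emb_inl]
  rw [T.param_paramInv]
  exact ⟨_, rfl⟩

/-- The planar coordinate lies in the image of the parametrisation. [folklore] -/
theorem planar_mem_range_param (c : 𝕊 3) : T.planar c ∈ range T.param := ⟨_, rfl⟩

/-- **The patch is injective over the image of the parametrisation** (there it factors through the
injective thickening: `β (param y) = emb (y, 0)`). [folklore] -/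
theorem injOn_patch : InjOn β (range T.param) := by
  rintro _ ⟨y, rfl⟩ _ ⟨y', rfl⟩ h
  rw [← T.emb_inl, ← T.emb_inl] at h
  have := slabEquiv.symm.injective (T.injective_emb h)
  rw [Prod.mk.injEq] at this
  rw [this.1]

/-- The collar square of width `δ₁` lies in the image of the thickening (under the patch).
[folklore] -/
theorem apply_mem_range_emb_of_mem_squareNhd {x : 𝔼 2} (hx : x ∈ squareNhd δ₁) : β x ∈ range T.emb :=
  T.apply_mem_range_emb (T.squareNhd_subset hx)

/-! ### Smoothness of the coordinates along smooth curves -/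

/-- The chart is `MDifferentiable` in the sense of open partial homeomorphisms (both it and its
inverse are differentiable on source and target). [folklore] -/
theorem mdifferentiable_chart : T.chart.MDifferentiable (𝓡 3) 𝓘(ℝ, 𝔼 3) :=
  ⟨(T.contMDiffOn_chart).mdifferentiableOn (by simp),
    (T.contMDiff_chart_symm).contMDiffOn.mdifferentiableOn (by simp)⟩

/-- The differential of the chart at a point of the image of the thickening is injective.
[folklore] -/
theorem mfderiv_chart_injective {c : 𝕊 3} (hc : c ∈ range T.emb) :
    Injective (mfderiv (𝓡 3) 𝓘(ℝ, 𝔼 3) T.chart c) :=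
  T.mdifferentiable_chart.mfderiv_injective (by rwa [chart_source])

/-- The chart is smooth at points of the image of the thickening. [folklore] -/
theorem contMDiffAt_chart {c : 𝕊 3} (hc : c ∈ range T.emb) :
    ContMDiffAt (𝓡 3) 𝓘(ℝ, 𝔼 3) ∞ T.chart c :=
  (T.contMDiffOn_chart).contMDiffAt (by rw [chart_source]; exact T.isOpen_range.mem_nhds hc)

/-- **The chart value along a smooth curve is smooth** at parameters where the curve lies in the
image of the thickening. [folklore] -/
theorem contDiffAt_chart_comp {γ : ℝ → 𝕊 3} {t₀ : ℝ} (hγ : ContMDiffAt 𝓘(ℝ, ℝ) (𝓡 3) ∞ γ t₀)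
    (ht₀ : γ t₀ ∈ range T.emb) : ContDiffAt ℝ ∞ (fun t ↦ T.chart (γ t)) t₀ :=
  ((T.contMDiffAt_chart ht₀).comp t₀ hγ).contDiffAt

/-- **The planar coordinate along a smooth curve is smooth** at parameters where the curve lies in
the image of the thickening. [folklore] -/
theorem contDiffAt_planar_comp {γ : ℝ → 𝕊 3} {t₀ : ℝ} (hγ : ContMDiffAt 𝓘(ℝ, ℝ) (𝓡 3) ∞ γ t₀)
    (ht₀ : γ t₀ ∈ range T.emb) : ContDiffAt ℝ ∞ (fun t ↦ T.planar (γ t)) t₀ :=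
  T.contDiff_slabPlanar.contDiffAt.comp t₀ (T.contDiffAt_chart_comp hγ ht₀)

/-- **The height along a smooth curve is smooth** at parameters where the curve lies in the image
of the thickening. [folklore] -/
theorem contDiffAt_height_comp {γ : ℝ → 𝕊 3} {t₀ : ℝ} (hγ : ContMDiffAt 𝓘(ℝ, ℝ) (𝓡 3) ∞ γ t₀)
    (ht₀ : γ t₀ ∈ range T.emb) : ContDiffAt ℝ ∞ (fun t ↦ T.height (γ t)) t₀ :=
  (contDiff_snd.comp slabEquiv.contDiff).contDiffAt.comp t₀ (T.contDiffAt_chart_comp hγ ht₀)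

/-- A smooth curve which meets the image of the thickening stays in it for nearby parameters.
[folklore] -/
theorem eventually_mem_range_emb {γ : ℝ → 𝕊 3} {t₀ : ℝ} (hγ : Continuous γ) (ht₀ : γ t₀ ∈ range T.emb) :
    ∀ᶠ t in 𝓝 t₀, γ t ∈ range T.emb :=
  hγ.continuousAt.preimage_mem_nhds (T.isOpen_range.mem_nhds ht₀)

end PatchThickening


/-! ## One-variable calculus at a junction parameter -/

section Calculus

variable {F : Type*} [NormedAddCommGroup F] [NormedSpace ℝ F]

/-- A function which is differentiable at `a` and constant on a right neighbourhood `[a, a + ε)`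
has derivative zero at `a` (the derivative is the right derivative). [folklore] -/
theorem deriv_eq_zero_of_eventuallyEq_const_Ici {f : ℝ → F} {a : ℝ} {c : F} (hf : DifferentiableAt ℝ f a)
    (h : ∀ᶠ t in 𝓝[Ici a] a, f t = c) : deriv f a = 0 := by
  rw [← hf.derivWithin (uniqueDiffWithinAt_Ici a)]
  have hfa : f a = c := h.self_of_nhdsWithin (mem_Ici.2 le_rfl)
  rw [EventuallyEq.derivWithin_eq (show f =ᶠ[𝓝[Ici a] a] fun _ ↦ c from h) (by simp [hfa])]
  simp

/-- A function which is differentiable at `a` and has a one-sided minimum at `a` from the right has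
nonnegative derivative at `a`. [folklore] -/
theorem deriv_nonneg_of_eventually_le_Ioi {f : ℝ → ℝ} {a : ℝ} (hf : DifferentiableAt ℝ f a)
    (h : ∀ᶠ t in 𝓝[>] a, f a ≤ f t) : 0 ≤ deriv f a := by
  have hd : HasDerivWithinAt f (deriv f a) (Ioi a) a := hf.hasDerivAt.hasDerivWithinAt
  rw [hasDerivWithinAt_iff_tendsto_slope, sdiff_singleton_eq_self (by simp)] at hd
  refine ge_of_tendsto hd ?_
  filter_upwards [h, self_mem_nhdsWithin] with t ht hta
  rw [slope_def_field]
  exact div_nonneg (sub_nonneg.2 ht) (sub_pos.2 hta).le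

/-- A function with positive derivative at `a` is below its value at `a` just left of `a`.
[folklore] -/
theorem eventually_lt_of_deriv_pos {f : ℝ → ℝ} {a f' : ℝ} (hf : HasDerivAt f f' a) (hf' : 0 < f') :
    ∀ᶠ t in 𝓝[<] a, f t < f a := by
  have ht : Tendsto (slope f a) (𝓝[≠] a) (𝓝 f') := hasDerivAt_iff_tendsto_slope.1 hf
  have h1 : ∀ᶠ t in 𝓝[<] a, 0 < slope f a t :=
    (ht.mono_left (nhdsWithin_mono _ fun t ht ↦ ne_of_lt ht)).eventually_const_lt hf'
  filter_upwards [h1, self_mem_nhdsWithin] with t h1 hta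
  rw [slope_def_field] at h1
  have hta' : t - a < 0 := sub_neg.2 hta
  rcases div_pos_iff.1 h1 with ⟨_, h⟩ | ⟨h, _⟩
  · linarith
  · linarith

/-- A function with positive derivative at `a` is above its value at `a` just right of `a`.
[folklore] -/
theorem eventually_gt_of_deriv_pos {f : ℝ → ℝ} {a f' : ℝ} (hf : HasDerivAt f f' a) (hf' : 0 < f') :
    ∀ᶠ t in 𝓝[>] a, f a < f t := by
  have ht : Tendsto (slope f a) (𝓝[≠] a) (𝓝 f') := hasDerivAt_iff_tendsto_slope.1 hf
  have h1 : ∀ᶠ t in 𝓝[>] a, 0 < slope f a t :=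
    (ht.mono_left (nhdsWithin_mono _ fun t ht ↦ ne_of_gt ht)).eventually_const_lt hf'
  filter_upwards [h1, self_mem_nhdsWithin] with t h1 hta
  rw [slope_def_field] at h1
  have hta' : 0 < t - a := sub_pos.2 hta
  rcases div_pos_iff.1 h1 with ⟨h, _⟩ | ⟨_, h⟩
  · linarith
  · linarith

/-- The derivative of a `C^∞` function (at a point) is continuous at that point. [folklore] -/
theorem continuousAt_deriv_of_contDiffAt {f : ℝ → F} {a : ℝ} (hf : ContDiffAt ℝ ∞ f a) :
    ContinuousAt (deriv f) a := by
  obtain ⟨f', u, hu, hcont, hderiv⟩ := contDiffAt_one_iff.1 (hf.of_le (by exact_mod_cast le_top))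
  have heq : (fun x ↦ f' x 1) =ᶠ[𝓝 a] deriv f := by
    filter_upwards [hu] with x hx
    rw [← fderiv_apply_one_eq_deriv, (hderiv x hx).fderiv]
  have h1 : ContinuousAt (fun x ↦ f' x 1) a :=
    ((ContinuousLinearMap.apply ℝ F (1 : ℝ)).continuous.continuousAt).comp (hcont.continuousAt hu)
  exact h1.congr heq

/-- A `C^∞` function with positive derivative at `a` has positive derivative near `a`. [folklore] -/
theorem eventually_deriv_pos {f : ℝ → ℝ} {a : ℝ} (hf : ContDiffAt ℝ ∞ f a) (ha : 0 < deriv f a) :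
    ∀ᶠ t in 𝓝 a, 0 < deriv f t :=
  (continuousAt_deriv_of_contDiffAt hf).eventually (lt_mem_nhds ha)

/-- A `C^∞` function (at a point) is differentiable near the point. [folklore] -/
theorem eventually_differentiableAt {f : ℝ → F} {a : ℝ} (hf : ContDiffAt ℝ ∞ f a) :
    ∀ᶠ t in 𝓝 a, DifferentiableAt ℝ f t := by
  obtain ⟨f', u, hu, -, hderiv⟩ := contDiffAt_one_iff.1 (hf.of_le (by exact_mod_cast le_top))
  filter_upwards [hu] with x hx using (hderiv x hx).differentiableAt

end Calculus

/-! ## Transfer of the velocity relation to chart tracks -/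

namespace PatchThickening

variable {β : 𝔼 2 → 𝕊 3} {δ₀ δ₁ : ℝ} (T : PatchThickening β δ₀ δ₁)

/-- The velocity of the curve of a knot is the image under the differential of `𝕊³ ⊆ ℝ⁴` of the
tangent vector of the track `K ∘ circlePt`. [folklore] -/
theorem _root_.Literature.Topology.FourManifolds.Knot.deriv_curve_eq_mfderiv (K : Knot) (s : ℝ) :
    deriv K.curve s = mfderiv (𝓡 3) 𝓘(ℝ, 𝔼 4) (Subtype.val : 𝕊 3 → 𝔼 4) (K (circlePt s))
      (mfderiv 𝓘(ℝ, ℝ) (𝓡 3) (⇑K ∘ circlePt) s 1) := by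
  haveI := Fact.mk (@finrank_euclideanSpace_fin ℝ _ (3 + 1))
  have hc : MDifferentiableAt 𝓘(ℝ, ℝ) (𝓡 1) circlePt s :=
    contMDiff_circlePt.contMDiffAt.mdifferentiableAt (by simp)
  have hK : MDifferentiableAt (𝓡 1) (𝓡 3) K (circlePt s) :=
    K.contMDiff.contMDiffAt.mdifferentiableAt (by simp)
  have hval : MDifferentiableAt (𝓡 3) 𝓘(ℝ, 𝔼 4) (Subtype.val : 𝕊 3 → 𝔼 4) (K (circlePt s)) :=
    (contMDiff_coe_sphere (m := 1)).contMDiffAt.mdifferentiableAt one_ne_zero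
  have h1 : mfderiv 𝓘(ℝ, ℝ) 𝓘(ℝ, 𝔼 4) K.curve s =
      (mfderiv (𝓡 3) 𝓘(ℝ, 𝔼 4) (Subtype.val : 𝕊 3 → 𝔼 4) (K (circlePt s))).comp
        (mfderiv 𝓘(ℝ, ℝ) (𝓡 3) (⇑K ∘ circlePt) s) := by
    rw [show K.curve = Subtype.val ∘ (⇑K ∘ circlePt) from rfl]
    exact mfderiv_comp s hval (hK.comp s hc)
  rw [← fderiv_apply_one_eq_deriv, ← mfderiv_eq_fderiv, h1]
  rfl

/-- The track `K ∘ circlePt` of a knot is differentiable. [folklore] -/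
theorem _root_.Literature.Topology.FourManifolds.Knot.mdifferentiableAt_comp_circlePt (K : Knot) (s : ℝ) :
    MDifferentiableAt 𝓘(ℝ, ℝ) (𝓡 3) (⇑K ∘ circlePt) s :=
  (K.contMDiff.contMDiffAt.mdifferentiableAt (by simp)).comp s
    (contMDiff_circlePt.contMDiffAt.mdifferentiableAt (by simp))

/-- The track `K ∘ circlePt` of a knot is smooth. [folklore] -/
theorem _root_.Literature.Topology.FourManifolds.Knot.contMDiff_comp_circlePt (K : Knot) :
    ContMDiff 𝓘(ℝ, ℝ) (𝓡 3) ∞ (⇑K ∘ circlePt) :=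
  K.contMDiff.comp contMDiff_circlePt

/-- The velocity of the chart track `chart ∘ K ∘ circlePt` is the image under the differential of
the chart of the tangent vector of the track. [folklore] -/
theorem deriv_chart_track_eq_mfderiv (K : Knot) {s : ℝ} (hs : K (circlePt s) ∈ range T.emb) :
    deriv (fun t ↦ T.chart (K (circlePt t))) s = mfderiv (𝓡 3) 𝓘(ℝ, 𝔼 3) T.chart (K (circlePt s))
      (mfderiv 𝓘(ℝ, ℝ) (𝓡 3) (⇑K ∘ circlePt) s 1) := by
  have hch : MDifferentiableAt (𝓡 3) 𝓘(ℝ, 𝔼 3) T.chart (K (circlePt s)) :=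
    (T.contMDiffAt_chart hs).mdifferentiableAt (by simp)
  have h1 : mfderiv 𝓘(ℝ, ℝ) 𝓘(ℝ, 𝔼 3) (T.chart ∘ (⇑K ∘ circlePt)) s =
      (mfderiv (𝓡 3) 𝓘(ℝ, 𝔼 3) T.chart (K (circlePt s))).comp (mfderiv 𝓘(ℝ, ℝ) (𝓡 3) (⇑K ∘ circlePt) s) :=
    mfderiv_comp s hch (K.mdifferentiableAt_comp_circlePt s)
  rw [show (fun t ↦ T.chart (K (circlePt t))) = T.chart ∘ (⇑K ∘ circlePt) from rfl,
    ← fderiv_apply_one_eq_deriv, ← mfderiv_eq_fderiv, h1]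
  rfl

/-- **Transfer of a velocity relation to chart tracks.** If two knots pass through the same point
of the image of the thickening at parameters `a`, `a'` with `(K.curve)' a = μ • (K'.curve)' a'`,
then their chart tracks satisfy the same relation: the differential of `𝕊³ ⊆ ℝ⁴` is injective
(`mfderiv_coe_sphere_injective`) and the chart is differentiable. [folklore] -/
theorem deriv_chart_track_eq_smul {K K' : Knot} {a a' μ : ℝ} (hpt : K (circlePt a) = K' (circlePt a'))
    (hmem : K (circlePt a) ∈ range T.emb) (hvel : deriv K.curve a = μ • deriv K'.curve a') :
    deriv (fun t ↦ T.chart (K (circlePt t))) a = μ • deriv (fun t ↦ T.chart (K' (circlePt t))) a' := by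
  haveI := Fact.mk (@finrank_euclideanSpace_fin ℝ _ (3 + 1))
  have aux1 : ∀ {p p' : 𝕊 3}, p = p' → ∀ w w' : 𝔼 3,
      mfderiv (𝓡 3) 𝓘(ℝ, 𝔼 4) (Subtype.val : 𝕊 3 → 𝔼 4) p w =
        μ • mfderiv (𝓡 3) 𝓘(ℝ, 𝔼 4) (Subtype.val : 𝕊 3 → 𝔼 4) p' w' → w = μ • w' := by
    rintro p _ rfl w w' h
    rw [← map_smul] at h
    exact mfderiv_coe_sphere_injective (E := 𝔼 4) (n := 3) p h
  have aux2 : ∀ {p p' : 𝕊 3}, p = p' → ∀ w w' : 𝔼 3, w = μ • w' →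
      mfderiv (𝓡 3) 𝓘(ℝ, 𝔼 3) T.chart p w = μ • mfderiv (𝓡 3) 𝓘(ℝ, 𝔼 3) T.chart p' w' := by
    rintro p _ rfl w w' rfl
    exact (mfderiv (𝓡 3) 𝓘(ℝ, 𝔼 3) T.chart p).map_smul μ w'
  rw [K.deriv_curve_eq_mfderiv, K'.deriv_curve_eq_mfderiv] at hvel
  have key := aux1 hpt _ _ hvel
  rw [T.deriv_chart_track_eq_mfderiv K hmem, T.deriv_chart_track_eq_mfderiv K' (hpt ▸ hmem)]
  exact aux2 hpt _ _ key

end PatchThickening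


/-! ## Chain rules for tracks read in slab coordinates -/

section SlabCalculus

/-- Chain rule for a differentiable outer map and two curves with proportional velocities at a
common point. [folklore] -/
theorem deriv_comp_eq_smul_of_deriv_eq_smul {X : Type*} [NormedAddCommGroup X] [NormedSpace ℝ X]
    {G : 𝔼 3 → X} {e e' : ℝ → 𝔼 3} {a a' μ : ℝ} (hG : Differentiable ℝ G)
    (he : DifferentiableAt ℝ e a) (he' : DifferentiableAt ℝ e' a') (hpt : e a = e' a')
    (h : deriv e a = μ • deriv e' a') :
    deriv (fun t ↦ G (e t)) a = μ • deriv (fun t ↦ G (e' t)) a' := by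
  have h1 := ((hG (e a)).hasFDerivAt.comp_hasDerivAt a he.hasDerivAt).deriv
  have h2 := ((hG (e' a')).hasFDerivAt.comp_hasDerivAt a' he'.hasDerivAt).deriv
  show deriv (G ∘ e) a = μ • deriv (G ∘ e') a'
  rw [h1, h2, h, map_smul, hpt]

variable {β : 𝔼 2 → 𝕊 3} {δ₀ δ₁ : ℝ} (T : PatchThickening β δ₀ δ₁)

/-- A curve in `ℝ³` whose planar reading `slabPlanar ∘ e` and height `(slabEquiv ∘ e).2` both have
derivative zero has derivative zero (`param` is an immersion). [folklore] -/
theorem PatchThickening.deriv_eq_zero_of_slab {e : ℝ → 𝔼 3} {t₀ : ℝ} (he : DifferentiableAt ℝ e t₀)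
    (h1 : deriv (fun t ↦ T.slabPlanar (e t)) t₀ = 0) (h2 : deriv (fun t ↦ (slabEquiv (e t)).2) t₀ = 0) :
    deriv e t₀ = 0 := by
  -- the first slab coordinate
  have hfst : deriv (fun t ↦ (slabEquiv (e t)).1) t₀ = (slabEquiv (deriv e t₀)).1 := by
    have := (((ContinuousLinearMap.fst ℝ (𝔼 2) (𝔼 1)).comp
      (slabEquiv : (𝔼 3) ≃L[ℝ] (𝔼 2) × 𝔼 1).toContinuousLinearMap).hasFDerivAt.comp_hasDerivAt t₀
      he.hasDerivAt).deriv
    exact this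
  have hsnd : deriv (fun t ↦ (slabEquiv (e t)).2) t₀ = (slabEquiv (deriv e t₀)).2 := by
    have := (((ContinuousLinearMap.snd ℝ (𝔼 2) (𝔼 1)).comp
      (slabEquiv : (𝔼 3) ≃L[ℝ] (𝔼 2) × 𝔼 1).toContinuousLinearMap).hasFDerivAt.comp_hasDerivAt t₀
      he.hasDerivAt).deriv
    exact this
  -- the planar reading is `param` of the first slab coordinate
  have hpl : deriv (fun t ↦ T.slabPlanar (e t)) t₀ =
      fderiv ℝ T.param (slabEquiv (e t₀)).1 (slabEquiv (deriv e t₀)).1 := by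
    have hd1 : DifferentiableAt ℝ (fun t ↦ (slabEquiv (e t)).1) t₀ :=
      ((ContinuousLinearMap.fst ℝ (𝔼 2) (𝔼 1)).comp
        (slabEquiv : (𝔼 3) ≃L[ℝ] (𝔼 2) × 𝔼 1).toContinuousLinearMap).differentiableAt.comp t₀ he
    have := fderiv_comp_deriv (𝕜 := ℝ) (l := T.param) (f := fun t ↦ (slabEquiv (e t)).1) t₀
      (T.contDiff_param.differentiable (by simp) _) hd1
    rw [hfst] at this
    exact this
  rw [hpl] at h1
  rw [hsnd] at h2
  have h1' : (slabEquiv (deriv e t₀)).1 = 0 := by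
    have h0 : fderiv ℝ T.param (slabEquiv (e t₀)).1 (slabEquiv (deriv e t₀)).1 =
        fderiv ℝ T.param (slabEquiv (e t₀)).1 0 := by rw [h1, map_zero]
    exact T.injective_fderiv_param _ h0
  have : slabEquiv (deriv e t₀) = 0 := Prod.ext h1' h2
  simpa using this

end SlabCalculus

/-! ## The left attaching point `p = band (0, -δ)` in planar coordinates -/

namespace BandData

variable {K₁ K₂ K : Knot} {avoid : Set (𝕊 3)} (b : BandData K₁ K₂ K avoid)
variable {δ₀ δ₁ : ℝ} (T : PatchThickening b.band δ₀ δ₁)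

/-- The closed collar square lies in the image of the parametrisation of a thickening over a wider
collar. [folklore] -/
theorem closedSquare_subset_range_param (hδ₁ : b.δ < δ₁) : closedSquare b.δ ⊆ range T.param :=
  (closedSquare_subset_squareNhd hδ₁).trans T.squareNhd_subset

include T in
/-- With a thickening over a wider collar, the band is injective on the closed collar square (the
hypothesis `hcl` of `BandSumJunction.lean`). [folklore] -/
theorem injOn_band_closedSquare (hδ₁ : b.δ < δ₁) : InjOn b.band (closedSquare b.δ) :=
  InjOn.mono (b.closedSquare_subset_range_param T hδ₁) T.injOn_patch

/-- The planar left edge lies in the closed collar square. [folklore] -/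
theorem leftEdgePlanar_mem_closedSquare {s : ℝ} (hs : s ∈ Icc (0 : ℝ) 1) :
    b.leftEdgePlanar s ∈ closedSquare b.δ := by
  have hδ := b.δ_pos
  have h := b.leftEdge_height_mem hs
  rw [leftEdgePlanar, pt2_mem_closedSquare_iff]
  exact ⟨⟨by linarith, by linarith⟩, h⟩

/-- The attaching point `p = band (0, -δ)` lies in the image of the thickening. [folklore] -/
theorem band_lowerLeft_mem_range_emb (hδ₁ : b.δ < δ₁) : b.band (pt2 0 (-b.δ)) ∈ range T.emb :=
  T.apply_mem_range_emb (b.closedSquare_subset_range_param T hδ₁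
    (b.corner_mem_closedSquare (Or.inl rfl) (Or.inl rfl)))

/-- The planar coordinate of the attaching point `p` is the corner `(0, -δ)`. [folklore] -/
theorem planar_band_lowerLeft (hδ₁ : b.δ < δ₁) : T.planar (b.band (pt2 0 (-b.δ))) = pt2 0 (-b.δ) :=
  T.planar_apply_patch (b.closedSquare_subset_range_param T hδ₁
    (b.corner_mem_closedSquare (Or.inl rfl) (Or.inl rfl)))

/-- A lift of a closed arc reaches every parameter of its window. [folklore] -/
theorem _root_.Literature.Topology.FourManifolds.exists_eq_of_mem_Icc_lift {χ : ℝ → ℝ} (hχ : Continuous χ)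
    {t : ℝ} (ht : t ∈ Icc (χ 0) (χ 1)) : ∃ s ∈ Icc (0 : ℝ) 1, χ s = t :=
  intermediate_value_Icc zero_le_one hχ.continuousOn ht

/-- **The track of `K₁` over the window of the left edge, in coordinates**: planar coordinate on the
edge line `x₀ = 0` at height `-δ + s (1 + 2δ)`, height zero, inside the image of the thickening.
[folklore] -/
theorem left_track_of_mem_Icc (hδ₁ : b.δ < δ₁) {χ : ℝ → ℝ} (hχ : Continuous χ)
    (hχe : ∀ s ∈ Icc (0 : ℝ) 1, K₁ (circlePt (χ s)) = b.leftEdge s) {t : ℝ} (ht : t ∈ Icc (χ 0) (χ 1)) :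
    ∃ s ∈ Icc (0 : ℝ) 1, χ s = t ∧ K₁ (circlePt t) ∈ range T.emb ∧
      T.planar (K₁ (circlePt t)) = b.leftEdgePlanar s ∧ T.height (K₁ (circlePt t)) = 0 := by
  obtain ⟨s, hs, rfl⟩ := exists_eq_of_mem_Icc_lift hχ ht
  have hmem : b.leftEdgePlanar s ∈ range T.param :=
    b.closedSquare_subset_range_param T hδ₁ (b.leftEdgePlanar_mem_closedSquare hs)
  refine ⟨s, hs, rfl, ?_, ?_, ?_⟩
  · rw [hχe s hs]; exact T.apply_mem_range_emb hmem
  · rw [hχe s hs]; exact T.planar_apply_patch hmem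
  · rw [hχe s hs]; exact T.height_apply_patch hmem

/-- On the window of the left edge the planar `x₀`-coordinate of the track of `K₁` vanishes.
[folklore] -/
theorem planar_left_track_zero (hδ₁ : b.δ < δ₁) {χ : ℝ → ℝ} (hχ : Continuous χ)
    (hχe : ∀ s ∈ Icc (0 : ℝ) 1, K₁ (circlePt (χ s)) = b.leftEdge s) {t : ℝ} (ht : t ∈ Icc (χ 0) (χ 1)) :
    T.planar (K₁ (circlePt t)) 0 = 0 := by
  obtain ⟨s, -, -, -, hpl, -⟩ := b.left_track_of_mem_Icc T hδ₁ hχ hχe ht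
  rw [hpl]
  simp [leftEdgePlanar, pt2]

/-- On the window of the left edge the planar `x₁`-coordinate of the track of `K₁` is at least
`-δ`. [folklore] -/
theorem neg_delta_le_planar_left_track_one (hδ₁ : b.δ < δ₁) {χ : ℝ → ℝ} (hχ : Continuous χ)
    (hχe : ∀ s ∈ Icc (0 : ℝ) 1, K₁ (circlePt (χ s)) = b.leftEdge s) {t : ℝ} (ht : t ∈ Icc (χ 0) (χ 1)) :
    -b.δ ≤ T.planar (K₁ (circlePt t)) 1 := by
  obtain ⟨s, hs, -, -, hpl, -⟩ := b.left_track_of_mem_Icc T hδ₁ hχ hχe ht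
  rw [hpl]
  have hδ := b.δ_pos
  simp only [leftEdgePlanar, pt2]
  show -b.δ ≤ (WithLp.toLp 2 ![0, -b.δ + s * (1 + 2 * b.δ)]) 1
  simp only [Matrix.cons_val_one, Matrix.cons_val_zero]
  nlinarith [hs.1]

/-- The chart track of a knot is smooth at parameters over the image of the thickening.
[folklore] -/
theorem _root_.Literature.Topology.FourManifolds.PatchThickening.contDiffAt_chart_track
    {β : 𝔼 2 → 𝕊 3} {δ₀ δ₁ : ℝ} (T : PatchThickening β δ₀ δ₁) (K : Knot) {t₀ : ℝ}
    (ht₀ : K (circlePt t₀) ∈ range T.emb) : ContDiffAt ℝ ∞ (fun t ↦ T.chart (K (circlePt t))) t₀ :=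
  T.contDiffAt_chart_comp (K.contMDiff_comp_circlePt t₀) ht₀

/-- The planar track of a knot is smooth at parameters over the image of the thickening.
[folklore] -/
theorem _root_.Literature.Topology.FourManifolds.PatchThickening.contDiffAt_planar_track
    {β : 𝔼 2 → 𝕊 3} {δ₀ δ₁ : ℝ} (T : PatchThickening β δ₀ δ₁) (K : Knot) {t₀ : ℝ}
    (ht₀ : K (circlePt t₀) ∈ range T.emb) : ContDiffAt ℝ ∞ (fun t ↦ T.planar (K (circlePt t))) t₀ :=
  T.contDiffAt_planar_comp (K.contMDiff_comp_circlePt t₀) ht₀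

/-- A coordinate of the planar track of a knot is smooth at parameters over the image of the
thickening. [folklore] -/
theorem _root_.Literature.Topology.FourManifolds.PatchThickening.contDiffAt_planar_track_apply
    {β : 𝔼 2 → 𝕊 3} {δ₀ δ₁ : ℝ} (T : PatchThickening β δ₀ δ₁) (K : Knot) {t₀ : ℝ}
    (ht₀ : K (circlePt t₀) ∈ range T.emb) (i : Fin 2) :
    ContDiffAt ℝ ∞ (fun t ↦ T.planar (K (circlePt t)) i) t₀ :=
  contDiffAt_euclidean.1 (T.contDiffAt_planar_track K ht₀) i

/-- The height track of a knot is smooth at parameters over the image of the thickening.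
[folklore] -/
theorem _root_.Literature.Topology.FourManifolds.PatchThickening.contDiffAt_height_track
    {β : 𝔼 2 → 𝕊 3} {δ₀ δ₁ : ℝ} (T : PatchThickening β δ₀ δ₁) (K : Knot) {t₀ : ℝ}
    (ht₀ : K (circlePt t₀) ∈ range T.emb) : ContDiffAt ℝ ∞ (fun t ↦ T.height (K (circlePt t))) t₀ :=
  T.contDiffAt_height_comp (K.contMDiff_comp_circlePt t₀) ht₀

/-- **The chart track of a knot is a regular curve**: its velocity never vanishes (over the image
of the thickening), the knot being an immersion, `circlePt` a local diffeomorphism and the chart a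
diffeomorphism onto its image. [folklore] -/
theorem _root_.Literature.Topology.FourManifolds.PatchThickening.deriv_chart_track_ne_zero
    {β : 𝔼 2 → 𝕊 3} {δ₀ δ₁ : ℝ} (T : PatchThickening β δ₀ δ₁) (K : Knot) {t₀ : ℝ}
    (ht₀ : K (circlePt t₀) ∈ range T.emb) : deriv (fun t ↦ T.chart (K (circlePt t))) t₀ ≠ 0 := by
  haveI := Fact.mk (@finrank_euclideanSpace_fin ℝ _ (3 + 1))
  rw [T.deriv_chart_track_eq_mfderiv K ht₀]
  have h1 := mfderiv_circlePt_injective t₀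
  obtain ⟨F, _, _, hF⟩ := K.isSmoothEmbedding.isImmersion
  have h2 : Injective (mfderiv (𝓡 1) (𝓡 3) K (circlePt t₀)) :=
    Manifold.IsImmersionAtOfComplement.mfderiv_injective (hF (circlePt t₀)) (by simp)
  have h3 := T.mfderiv_chart_injective ht₀
  have hc : MDifferentiableAt 𝓘(ℝ, ℝ) (𝓡 1) circlePt t₀ :=
    contMDiff_circlePt.contMDiffAt.mdifferentiableAt (by simp)
  have hK : MDifferentiableAt (𝓡 1) (𝓡 3) K (circlePt t₀) :=
    K.contMDiff.contMDiffAt.mdifferentiableAt (by simp)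
  have hchain : mfderiv 𝓘(ℝ, ℝ) (𝓡 3) (⇑K ∘ circlePt) t₀ =
      (mfderiv (𝓡 1) (𝓡 3) K (circlePt t₀)).comp (mfderiv 𝓘(ℝ, ℝ) (𝓡 1) circlePt t₀) :=
    mfderiv_comp t₀ hK hc
  have hinj : Injective ((mfderiv (𝓡 3) 𝓘(ℝ, 𝔼 3) T.chart (K (circlePt t₀))).comp
      (mfderiv 𝓘(ℝ, ℝ) (𝓡 3) (⇑K ∘ circlePt) t₀)) := by
    rw [hchain]
    exact h3.comp (h2.comp h1)
  intro h0
  have h10 : (1 : ℝ) = 0 := (injective_iff_map_eq_zero _).1 hinj 1 h0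
  exact one_ne_zero h10

/-- **Flatness of `K₁` at `p`, first order**: the planar `x₀`-coordinate of the track of `K₁` has
derivative zero at `χ 0` (it vanishes identically on the window of the left edge, to the right of
`χ 0`). [folklore] -/
theorem deriv_planar_left_track_zero (hδ₁ : b.δ < δ₁) {χ : ℝ → ℝ} (hχ : Continuous χ)
    (hχm : StrictMonoOn χ (Icc 0 1)) (hχe : ∀ s ∈ Icc (0 : ℝ) 1, K₁ (circlePt (χ s)) = b.leftEdge s) :
    deriv (fun t ↦ T.planar (K₁ (circlePt t)) 0) (χ 0) = 0 := by
  have hp₁ : K₁ (circlePt (χ 0)) = b.band (pt2 0 (-b.δ)) := by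
    rw [hχe 0 (left_mem_Icc.2 zero_le_one), leftEdge_zero]
  have hmem : K₁ (circlePt (χ 0)) ∈ range T.emb := hp₁ ▸ b.band_lowerLeft_mem_range_emb T hδ₁
  have hχ01 : χ 0 < χ 1 := hχm (left_mem_Icc.2 zero_le_one) (right_mem_Icc.2 zero_le_one) zero_lt_one
  refine deriv_eq_zero_of_eventuallyEq_const_Ici (c := (0 : ℝ))
    ((T.contDiffAt_planar_track_apply K₁ hmem 0).differentiableAt (by simp)) ?_
  filter_upwards [Icc_mem_nhdsGE hχ01] with t ht
  exact b.planar_left_track_zero T hδ₁ hχ hχe ht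

/-- The height of the track of `K₁` has derivative zero at `χ 0`. [folklore] -/
theorem deriv_height_left_track (hδ₁ : b.δ < δ₁) {χ : ℝ → ℝ} (hχ : Continuous χ)
    (hχm : StrictMonoOn χ (Icc 0 1)) (hχe : ∀ s ∈ Icc (0 : ℝ) 1, K₁ (circlePt (χ s)) = b.leftEdge s) :
    deriv (fun t ↦ T.height (K₁ (circlePt t))) (χ 0) = 0 := by
  have hp₁ : K₁ (circlePt (χ 0)) = b.band (pt2 0 (-b.δ)) := by
    rw [hχe 0 (left_mem_Icc.2 zero_le_one), leftEdge_zero]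
  have hmem : K₁ (circlePt (χ 0)) ∈ range T.emb := hp₁ ▸ b.band_lowerLeft_mem_range_emb T hδ₁
  have hχ01 : χ 0 < χ 1 := hχm (left_mem_Icc.2 zero_le_one) (right_mem_Icc.2 zero_le_one) zero_lt_one
  refine deriv_eq_zero_of_eventuallyEq_const_Ici (c := (0 : 𝔼 1))
    ((T.contDiffAt_height_track K₁ hmem).differentiableAt (by simp)) ?_
  filter_upwards [Icc_mem_nhdsGE hχ01] with t ht
  obtain ⟨s, -, -, -, -, h0⟩ := b.left_track_of_mem_Icc T hδ₁ hχ hχe ht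
  exact h0

/-- Coordinates of the derivative of the planar track. [folklore] -/
theorem _root_.Literature.Topology.FourManifolds.PatchThickening.deriv_planar_track_apply
    {β : 𝔼 2 → 𝕊 3} {δ₀ δ₁ : ℝ} (T : PatchThickening β δ₀ δ₁) (K : Knot) {t₀ : ℝ}
    (ht₀ : K (circlePt t₀) ∈ range T.emb) (i : Fin 2) :
    deriv (fun t ↦ T.planar (K (circlePt t)) i) t₀ = deriv (fun t ↦ T.planar (K (circlePt t))) t₀ i := by
  have hd : DifferentiableAt ℝ (fun t ↦ T.planar (K (circlePt t))) t₀ :=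
    (T.contDiffAt_planar_track K ht₀).differentiableAt (by simp)
  exact ((EuclideanSpace.proj i : 𝔼 2 →L[ℝ] ℝ).hasFDerivAt.comp_hasDerivAt t₀ hd.hasDerivAt).deriv

/-- **`K₁` leaves `p` upwards with positive planar speed**: the planar `x₁`-coordinate of the track
of `K₁` has positive derivative at `χ 0`. It is nonnegative since `x₁ ≥ -δ` to the right of `χ 0`,
and nonzero since otherwise the planar velocity and the height velocity would both vanish,
contradicting the regularity of the chart track. [folklore] -/
theorem deriv_planar_left_track_one_pos (hδ₁ : b.δ < δ₁) {χ : ℝ → ℝ} (hχ : Continuous χ)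
    (hχm : StrictMonoOn χ (Icc 0 1)) (hχe : ∀ s ∈ Icc (0 : ℝ) 1, K₁ (circlePt (χ s)) = b.leftEdge s) :
    0 < deriv (fun t ↦ T.planar (K₁ (circlePt t)) 1) (χ 0) := by
  have hp₁ : K₁ (circlePt (χ 0)) = b.band (pt2 0 (-b.δ)) := by
    rw [hχe 0 (left_mem_Icc.2 zero_le_one), leftEdge_zero]
  have hmem : K₁ (circlePt (χ 0)) ∈ range T.emb := hp₁ ▸ b.band_lowerLeft_mem_range_emb T hδ₁
  have hχ01 : χ 0 < χ 1 := hχm (left_mem_Icc.2 zero_le_one) (right_mem_Icc.2 zero_le_one) zero_lt_one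
  have hval : T.planar (K₁ (circlePt (χ 0))) 1 = -b.δ := by
    rw [hp₁, b.planar_band_lowerLeft T hδ₁]
    simp
  -- nonnegative
  have hnn : 0 ≤ deriv (fun t ↦ T.planar (K₁ (circlePt t)) 1) (χ 0) := by
    refine deriv_nonneg_of_eventually_le_Ioi
      ((T.contDiffAt_planar_track_apply K₁ hmem 1).differentiableAt (by simp)) ?_
    filter_upwards [Ioo_mem_nhdsGT hχ01] with t ht
    rw [hval]
    exact b.neg_delta_le_planar_left_track_one T hδ₁ hχ hχe (Ioo_subset_Icc_self ht)
  refine lt_of_le_of_ne hnn fun h1 ↦ ?_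
  -- if it vanished, the chart track would have velocity zero
  have hd : DifferentiableAt ℝ (fun t ↦ T.chart (K₁ (circlePt t))) (χ 0) :=
    (T.contDiffAt_chart_track K₁ hmem).differentiableAt (by simp)
  refine T.deriv_chart_track_ne_zero K₁ hmem (T.deriv_eq_zero_of_slab hd ?_ ?_)
  · -- planar velocity zero: both coordinates vanish
    show deriv (fun t ↦ T.planar (K₁ (circlePt t))) (χ 0) = 0
    ext i
    fin_cases i
    · rw [← T.deriv_planar_track_apply K₁ hmem]
      exact b.deriv_planar_left_track_zero T hδ₁ hχ hχm hχe
    · rw [← T.deriv_planar_track_apply K₁ hmem]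
      exact h1.symm
  · exact b.deriv_height_left_track T hδ₁ hχ hχm hχe

/-! ### The track of `K` at `p` -/

/-- **`K` arrives at `p` with positive planar `x₁`-speed.** For a lift `φ` of the lower arc, the
planar `x₁`-coordinate of the track of `K` has positive derivative at `φ 0`: by junction analysis I
(`exists_pos_deriv_curve_eq_smul_left`) the velocity of `K` at `p` is a positive multiple of that of
`K₁`, the relation transfers to chart tracks (`deriv_chart_track_eq_smul`) and hence to the planar
`x₁`-coordinate, which increases along `K₁` (`deriv_planar_left_track_one_pos`). [folklore] -/
theorem deriv_planar_track_one_pos (hδ₁ : b.δ < δ₁) (hdisj : Disjoint (range K₁) (range K₂))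
    {φ : ℝ → ℝ} (hφ : Continuous φ) (hφm : StrictMonoOn φ (Icc 0 1))
    (hφℓ : ∀ s ∈ Icc (0 : ℝ) 1, K (circlePt (φ s)) = b.lowerCurve s) :
    0 < deriv (fun t ↦ T.planar (K (circlePt t)) 1) (φ 0) := by
  obtain ⟨χ, hχ, hχm, hχe⟩ := b.exists_lift_leftEdge
  have hp : K (circlePt (φ 0)) = b.band (pt2 0 (-b.δ)) := by
    rw [hφℓ 0 (left_mem_Icc.2 zero_le_one), lowerCurve_zero]
  have hp₁ : K₁ (circlePt (χ 0)) = b.band (pt2 0 (-b.δ)) := by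
    rw [hχe 0 (left_mem_Icc.2 zero_le_one), leftEdge_zero]
  have hpt : K (circlePt (φ 0)) = K₁ (circlePt (χ 0)) := hp.trans hp₁.symm
  have hmem : K (circlePt (φ 0)) ∈ range T.emb := hp ▸ b.band_lowerLeft_mem_range_emb T hδ₁
  have hmem₁ : K₁ (circlePt (χ 0)) ∈ range T.emb := hp₁ ▸ b.band_lowerLeft_mem_range_emb T hδ₁
  obtain ⟨μ, hμ, hvel⟩ := b.exists_pos_deriv_curve_eq_smul_left (b.injOn_band_closedSquare T hδ₁) hdisj
    hφ hφm hφℓ hχ hχm hχe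
  have hch := T.deriv_chart_track_eq_smul hpt hmem hvel
  have hG : Differentiable ℝ (fun w : 𝔼 3 ↦ T.slabPlanar w 1) := fun w ↦
    (EuclideanSpace.proj (1 : Fin 2) : 𝔼 2 →L[ℝ] ℝ).differentiableAt.comp w
      (T.contDiff_slabPlanar.differentiable (by simp) w)
  have key := deriv_comp_eq_smul_of_deriv_eq_smul (G := fun w : 𝔼 3 ↦ T.slabPlanar w 1) hG
    ((T.contDiffAt_chart_track K hmem).differentiableAt (by simp))
    ((T.contDiffAt_chart_track K₁ hmem₁).differentiableAt (by simp)) (by simp only [hpt]) hch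
  have h₁ := b.deriv_planar_left_track_one_pos T hδ₁ hχ hχm hχe
  change deriv (fun t ↦ T.planar (K (circlePt t)) 1) (φ 0) =
    μ • deriv (fun t ↦ T.planar (K₁ (circlePt t)) 1) (χ 0) at key
  rw [key, smul_eq_mul]
  exact mul_pos hμ h₁

/-- **Just before `p`, `K` projects strictly below the edge line** (germ form): for parameters
`t < φ 0` close to `φ 0` the point `K (circlePt t)` lies in the image of the thickening and its
planar `x₁`-coordinate is `< -δ`. [folklore] -/
theorem eventually_planar_track_one_lt (hδ₁ : b.δ < δ₁) (hdisj : Disjoint (range K₁) (range K₂))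
    {φ : ℝ → ℝ} (hφ : Continuous φ) (hφm : StrictMonoOn φ (Icc 0 1))
    (hφℓ : ∀ s ∈ Icc (0 : ℝ) 1, K (circlePt (φ s)) = b.lowerCurve s) :
    ∀ᶠ t in 𝓝[<] (φ 0), K (circlePt t) ∈ range T.emb ∧ T.planar (K (circlePt t)) 1 < -b.δ := by
  have hp : K (circlePt (φ 0)) = b.band (pt2 0 (-b.δ)) := by
    rw [hφℓ 0 (left_mem_Icc.2 zero_le_one), lowerCurve_zero]
  have hmem : K (circlePt (φ 0)) ∈ range T.emb := hp ▸ b.band_lowerLeft_mem_range_emb T hδ₁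
  have hval : T.planar (K (circlePt (φ 0))) 1 = -b.δ := by
    rw [hp, b.planar_band_lowerLeft T hδ₁]
    simp
  have hd : HasDerivAt (fun t ↦ T.planar (K (circlePt t)) 1)
      (deriv (fun t ↦ T.planar (K (circlePt t)) 1) (φ 0)) (φ 0) :=
    ((T.contDiffAt_planar_track_apply K hmem 1).differentiableAt (by simp)).hasDerivAt
  have h1 := eventually_lt_of_deriv_pos hd (b.deriv_planar_track_one_pos T hδ₁ hdisj hφ hφm hφℓ)
  have h2 : ∀ᶠ t in 𝓝[<] (φ 0), K (circlePt t) ∈ range T.emb :=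
    (T.eventually_mem_range_emb (K.continuous.comp continuous_circlePt) hmem).filter_mono
      nhdsWithin_le_nhds
  filter_upwards [h1, h2] with t ht1 ht2
  exact ⟨ht2, by rwa [hval] at ht1⟩

/-- The open lower arc, on `𝕊³`, lies in the band surface. [folklore] -/
theorem lowerCurve_mem_support {s : ℝ} (hs : s ∈ Ioo (0 : ℝ) 1) : b.lowerCurve s ∈ b.support :=
  ⟨b.lowerArc s, (b.lowerArc_mem s hs).1, rfl⟩

/-- **Near `p`, points of `K` off the band surface project strictly below the edge line** (set
form of `eventually_planar_track_one_lt`): there is `r > 0` such that every point of `K` within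
distance `r` of `p = band (0, -δ)`, off the band surface and other than `p`, lies in the image of the
thickening and has planar `x₁`-coordinate `< -δ`. Such points are `K (circlePt t)` with `t` just
left of `φ 0` modulo the period: parameters in `[φ 0, φ 0 + κ)` give `p` or points of the open lower
arc (in the band surface), and the parameters in `[φ 0 + κ, φ 0 + 1 - κ]` give a compact set not
containing `p`. [folklore] -/
theorem exists_radius_planar_one_lt (hδ₁ : b.δ < δ₁) (hdisj : Disjoint (range K₁) (range K₂)) :
    ∃ r > 0, ∀ c ∈ range K, dist c (b.band (pt2 0 (-b.δ))) < r → c ∉ b.support →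
      c ≠ b.band (pt2 0 (-b.δ)) → c ∈ range T.emb ∧ T.planar c 1 < -b.δ := by
  obtain ⟨φ, hφ, hφm, hφℓ⟩ := b.exists_lift_lowerCurve
  have hp : K (circlePt (φ 0)) = b.band (pt2 0 (-b.δ)) := by
    rw [hφℓ 0 (left_mem_Icc.2 zero_le_one), lowerCurve_zero]
  have hφ01 : φ 0 < φ 1 := hφm (left_mem_Icc.2 zero_le_one) (right_mem_Icc.2 zero_le_one) zero_lt_one
  have hφ1 : φ 1 < φ 0 + 1 := b.lift_lowerCurve_one_lt (b.injOn_band_closedSquare T hδ₁) hφ hφm hφℓ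
  obtain ⟨l, hl, hlsub⟩ := mem_nhdsLT_iff_exists_Ioo_subset.1
    (b.eventually_planar_track_one_lt T hδ₁ hdisj hφ hφm hφℓ)
  have hl' : l < φ 0 := hl
  -- a margin `κ` below the three relevant gaps
  set κ : ℝ := min (φ 0 - l) (min (φ 1 - φ 0) (φ 0 + 1 - φ 1)) / 2 with hκ
  have hκpos : 0 < κ := by
    have : 0 < min (φ 0 - l) (min (φ 1 - φ 0) (φ 0 + 1 - φ 1)) :=
      lt_min (by linarith) (lt_min (by linarith) (by linarith))
    positivity
  have hκl : l ≤ φ 0 - κ := by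
    have : min (φ 0 - l) (min (φ 1 - φ 0) (φ 0 + 1 - φ 1)) ≤ φ 0 - l := min_le_left _ _
    linarith
  have hκ1 : φ 0 + κ ≤ φ 1 := by
    have : min (φ 0 - l) (min (φ 1 - φ 0) (φ 0 + 1 - φ 1)) ≤ φ 1 - φ 0 :=
      (min_le_right _ _).trans (min_le_left _ _)
    linarith
  have hκ2 : φ 1 ≤ φ 0 + 1 - κ := by
    have : min (φ 0 - l) (min (φ 1 - φ 0) (φ 0 + 1 - φ 1)) ≤ φ 0 + 1 - φ 1 :=
      (min_le_right _ _).trans (min_le_right _ _)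
    linarith
  -- the compact far part of `K` misses `p`
  set S : Set (𝕊 3) := (fun t ↦ K (circlePt t)) '' Icc (φ 0 + κ) (φ 0 + 1 - κ) with hS
  have hSc : IsCompact S := isCompact_Icc.image (K.continuous.comp continuous_circlePt)
  have hpS : b.band (pt2 0 (-b.δ)) ∉ S := by
    rintro ⟨t, ht, hpt⟩
    rw [← hp, K.apply_circlePt_eq_iff] at hpt
    obtain ⟨m, hm⟩ := hpt
    have h1 : (0 : ℝ) < m := by linarith [ht.1]
    have h2 : (m : ℝ) < 1 := by linarith [ht.2]
    have h1' : (0 : ℤ) < m := by exact_mod_cast h1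
    have h2' : m < (1 : ℤ) := by exact_mod_cast h2
    omega
  obtain ⟨r, hr, hrS⟩ := Metric.mem_nhds_iff.1 (hSc.isClosed.isOpen_compl.mem_nhds hpS)
  refine ⟨r, hr, ?_⟩
  rintro c ⟨x, rfl⟩ hdist hsupp hne
  obtain ⟨t', rfl⟩ : ∃ t', circlePt t' = x := ⟨angA x, circlePt_angA x⟩
  -- normalise the parameter into `[φ 0, φ 0 + 1)`
  set t : ℝ := t' - ⌊t' - φ 0⌋ with ht
  have hKt : K (circlePt t) = K (circlePt t') := by
    rw [ht, show t' - (⌊t' - φ 0⌋ : ℝ) = t' + ((-⌊t' - φ 0⌋ : ℤ) : ℝ) by push_cast; ring, circlePt_add_int]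
  have htI : t ∈ Ico (φ 0) (φ 0 + 1) := by
    have h1 := Int.floor_le (t' - φ 0)
    have h2 := Int.lt_floor_add_one (t' - φ 0)
    constructor <;> simp only [ht] <;> linarith
  have hnotS : K (circlePt t) ∉ S := fun h ↦ hrS (by rwa [mem_ball, hKt]) h
  have ht' : t < φ 0 + κ ∨ φ 0 + 1 - κ < t := by
    by_contra hcon
    simp only [not_or, not_lt] at hcon
    exact hnotS ⟨t, ⟨hcon.1, hcon.2⟩, rfl⟩
  rcases ht' with hlt | hgt
  · rcases htI.1.eq_or_lt with heq | hgt0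
    · exact absurd (by rw [← hKt, ← heq, hp]) hne
    · exfalso
      apply hsupp
      obtain ⟨s, hs, hse⟩ := b.apply_circlePt_mem_lowerCurve_image hφ hφm hφℓ ⟨hgt0, by linarith⟩
      rw [← hKt, ← hse]
      exact b.lowerCurve_mem_support hs
  · have hmem' : t - 1 ∈ Ioo l (φ 0) := ⟨by linarith, by linarith [htI.2]⟩
    have key : K (circlePt (t - 1)) ∈ range T.emb ∧ T.planar (K (circlePt (t - 1))) 1 < -b.δ :=
      hlsub hmem'
    have heq : K (circlePt (t - 1)) = K (circlePt t') := by
      rw [← hKt, show t - 1 = t + ((-1 : ℤ) : ℝ) by push_cast; ring, circlePt_add_int]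
    rw [heq] at key
    exact key

/-! ### Just before `p`, `K` runs on `K₁` just before `p` (pointwise form) -/

/-- The open left edge, on `𝕊³`, lies in the band surface. [folklore] -/
theorem leftEdge_mem_support {s : ℝ} (hs : s ∈ Ioo (0 : ℝ) 1) : b.leftEdge s ∈ b.support :=
  ⟨b.leftEdgePlanar s, (b.leftEdgePlanar_mem hs).1, rfl⟩

/-- **Near `p`, points of `K₁` off the band surface have parameters just left of `χ 0`**: there is
`r > 0` such that every `K₁ (circlePt u')` within distance `r` of `p`, off the band surface and
other than `p`, is `K₁ (circlePt u)` with `u ∈ (χ 0 - κ, χ 0)`, for any prescribed `κ > 0`.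
[folklore] -/
theorem exists_radius_left_param (hcl : InjOn b.band (closedSquare b.δ)) {χ : ℝ → ℝ} (hχ : Continuous χ)
    (hχm : StrictMonoOn χ (Icc 0 1)) (hχe : ∀ s ∈ Icc (0 : ℝ) 1, K₁ (circlePt (χ s)) = b.leftEdge s)
    {κ : ℝ} (hκ : 0 < κ) :
    ∃ r > 0, ∀ u' : ℝ, dist (K₁ (circlePt u')) (b.band (pt2 0 (-b.δ))) < r →
      K₁ (circlePt u') ∉ b.support → K₁ (circlePt u') ≠ b.band (pt2 0 (-b.δ)) →
      ∃ u ∈ Ioo (χ 0 - κ) (χ 0), K₁ (circlePt u) = K₁ (circlePt u') := by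
  have hp₁ : K₁ (circlePt (χ 0)) = b.band (pt2 0 (-b.δ)) := by
    rw [hχe 0 (left_mem_Icc.2 zero_le_one), leftEdge_zero]
  have hχ01 : χ 0 < χ 1 := hχm (left_mem_Icc.2 zero_le_one) (right_mem_Icc.2 zero_le_one) zero_lt_one
  have hχ1 : χ 1 < χ 0 + 1 := b.lift_leftEdge_one_lt hcl hχ hχm hχe
  set κ' : ℝ := min κ (min (χ 1 - χ 0) (χ 0 + 1 - χ 1)) / 2 with hκ'
  have hκ'pos : 0 < κ' := by
    have : 0 < min κ (min (χ 1 - χ 0) (χ 0 + 1 - χ 1)) :=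
      lt_min hκ (lt_min (by linarith) (by linarith))
    positivity
  have hκ'κ : κ' ≤ κ := by
    have : min κ (min (χ 1 - χ 0) (χ 0 + 1 - χ 1)) ≤ κ := min_le_left _ _
    linarith
  have hκ'1 : χ 0 + κ' ≤ χ 1 := by
    have : min κ (min (χ 1 - χ 0) (χ 0 + 1 - χ 1)) ≤ χ 1 - χ 0 :=
      (min_le_right _ _).trans (min_le_left _ _)
    linarith
  have hκ'2 : χ 1 ≤ χ 0 + 1 - κ' := by
    have : min κ (min (χ 1 - χ 0) (χ 0 + 1 - χ 1)) ≤ χ 0 + 1 - χ 1 :=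
      (min_le_right _ _).trans (min_le_right _ _)
    linarith
  set S : Set (𝕊 3) := (fun t ↦ K₁ (circlePt t)) '' Icc (χ 0 + κ') (χ 0 + 1 - κ') with hS
  have hSc : IsCompact S := isCompact_Icc.image (K₁.continuous.comp continuous_circlePt)
  have hpS : b.band (pt2 0 (-b.δ)) ∉ S := by
    rintro ⟨t, ht, hpt⟩
    rw [← hp₁, K₁.apply_circlePt_eq_iff] at hpt
    obtain ⟨m, hm⟩ := hpt
    have h1 : (0 : ℝ) < m := by linarith [ht.1]
    have h2 : (m : ℝ) < 1 := by linarith [ht.2]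
    have h1' : (0 : ℤ) < m := by exact_mod_cast h1
    have h2' : m < (1 : ℤ) := by exact_mod_cast h2
    omega
  obtain ⟨r, hr, hrS⟩ := Metric.mem_nhds_iff.1 (hSc.isClosed.isOpen_compl.mem_nhds hpS)
  refine ⟨r, hr, fun u' hdist hsupp hne ↦ ?_⟩
  set u : ℝ := u' - ⌊u' - χ 0⌋ with hu
  have hKu : K₁ (circlePt u) = K₁ (circlePt u') := by
    rw [hu, show u' - (⌊u' - χ 0⌋ : ℝ) = u' + ((-⌊u' - χ 0⌋ : ℤ) : ℝ) by push_cast; ring, circlePt_add_int]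
  have huI : u ∈ Ico (χ 0) (χ 0 + 1) := by
    have h1 := Int.floor_le (u' - χ 0)
    have h2 := Int.lt_floor_add_one (u' - χ 0)
    constructor <;> simp only [hu] <;> linarith
  have hnotS : K₁ (circlePt u) ∉ S := fun h ↦ hrS (by rwa [mem_ball, hKu]) h
  have hu' : u < χ 0 + κ' ∨ χ 0 + 1 - κ' < u := by
    by_contra hcon
    simp only [not_or, not_lt] at hcon
    exact hnotS ⟨u, ⟨hcon.1, hcon.2⟩, rfl⟩
  rcases hu' with hlt | hgt
  · rcases huI.1.eq_or_lt with heq | hgt0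
    · exact absurd (by rw [← hKu, ← heq, hp₁]) hne
    · exfalso
      apply hsupp
      obtain ⟨s, hs, hse⟩ := K₁.apply_circlePt_mem_image_of_lift hχ.continuousOn
        (hχm.mono Ioo_subset_Icc_self) hχe (t := u) ⟨hgt0, by linarith⟩
      rw [← hKu, ← hse]
      exact b.leftEdge_mem_support hs
  · refine ⟨u - 1, ⟨by linarith, by linarith [huI.2]⟩, ?_⟩
    rw [← hKu, show u - 1 = u + ((-1 : ℤ) : ℝ) by push_cast; ring, circlePt_add_int]

/-- **Just before `p`, `K` runs on `K₁` just before `p`**: for `t < φ 0` close to `φ 0`,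
`K (circlePt t) = K₁ (circlePt u)` for some `u ∈ (χ 0 - κ, χ 0)` (`κ > 0` prescribed). By
`eventually_apply_circlePt_mem_left` such points of `K` lie on `K₁` off the band surface, they tend
to `p` and differ from `p`, and `exists_radius_left_param` applies. [folklore] -/
theorem eventually_exists_apply_eq_left (hcl : InjOn b.band (closedSquare b.δ))
    (hdisj : Disjoint (range K₁) (range K₂))
    {φ : ℝ → ℝ} (hφ : Continuous φ) (hφm : StrictMonoOn φ (Icc 0 1))
    (hφℓ : ∀ s ∈ Icc (0 : ℝ) 1, K (circlePt (φ s)) = b.lowerCurve s)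
    {χ : ℝ → ℝ} (hχ : Continuous χ) (hχm : StrictMonoOn χ (Icc 0 1))
    (hχe : ∀ s ∈ Icc (0 : ℝ) 1, K₁ (circlePt (χ s)) = b.leftEdge s) {κ : ℝ} (hκ : 0 < κ) :
    ∀ᶠ t in 𝓝[<] (φ 0), ∃ u ∈ Ioo (χ 0 - κ) (χ 0), K (circlePt t) = K₁ (circlePt u) := by
  have hp : K (circlePt (φ 0)) = b.band (pt2 0 (-b.δ)) := by
    rw [hφℓ 0 (left_mem_Icc.2 zero_le_one), lowerCurve_zero]
  obtain ⟨r, hr, hrad⟩ := b.exists_radius_left_param hcl hχ hχm hχe hκ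
  have h1 := b.eventually_apply_circlePt_mem_left hcl hdisj hφ hφm hφℓ
  have h2 : ∀ᶠ t in 𝓝[<] (φ 0), dist (K (circlePt t)) (b.band (pt2 0 (-b.δ))) < r := by
    have hc : Tendsto (fun t ↦ K (circlePt t)) (𝓝[<] (φ 0)) (𝓝 (b.band (pt2 0 (-b.δ)))) := by
      rw [← hp]
      exact ((K.continuous.comp continuous_circlePt).tendsto (φ 0)).mono_left nhdsWithin_le_nhds
    exact hc (ball_mem_nhds _ hr)
  have h3 : ∀ᶠ t in 𝓝[<] (φ 0), t ∈ Ioo (φ 0 - 1) (φ 0) := Ioo_mem_nhdsLT (by linarith)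
  filter_upwards [h1, h2, h3] with t ht1 ht2 ht3
  obtain ⟨x, hx⟩ := ht1.1
  obtain ⟨u', rfl⟩ : ∃ u', circlePt u' = x := ⟨angA x, circlePt_angA x⟩
  have hne : K (circlePt t) ≠ b.band (pt2 0 (-b.δ)) := by
    rw [← hp]
    intro h
    obtain ⟨m, hm⟩ := K.apply_circlePt_eq_iff.1 h
    have h1 : (-1 : ℝ) < m := by linarith [ht3.1]
    have h2 : (m : ℝ) < 0 := by linarith [ht3.2]
    have h1' : (-1 : ℤ) < m := by exact_mod_cast h1
    have h2' : m < (0 : ℤ) := by exact_mod_cast h2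
    omega
  rw [← hx] at ht2 hne
  obtain ⟨u, hu, hue⟩ := hrad u' ht2 (hx ▸ ht1.2) hne
  exact ⟨u, hu, by rw [hue, hx]⟩

end BandData

/-! ## Local inverses of real functions with positive derivative -/

section LocalInverse

/-- **Local inverse of a real function with positive derivative**, packaged: a `C^∞` function `g`
near `a` with `g' a > 0` restricts, on some interval `(a - κ, a + κ)` (`κ ≤ κ₀` prescribed), to an
open partial homeomorphism `e` with that interval as source, strictly increasing with positive
derivative there, whose inverse is `C^∞` on the target (inverse function theorem,
`ContDiffAt.toOpenPartialHomeomorph`, `OpenPartialHomeomorph.contDiffAt_symm_deriv`). [folklore] -/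
theorem exists_openPartialHomeomorph_of_deriv_pos {g : ℝ → ℝ} {a κ₀ : ℝ} (hκ₀ : 0 < κ₀)
    (hg : ∀ t ∈ Ioo (a - κ₀) (a + κ₀), ContDiffAt ℝ ∞ g t) (hga : 0 < deriv g a) :
    ∃ κ ∈ Ioc 0 κ₀, ∃ e : OpenPartialHomeomorph ℝ ℝ, ⇑e = g ∧ e.source = Ioo (a - κ) (a + κ) ∧
      StrictMonoOn g (Ioo (a - κ) (a + κ)) ∧ (∀ t ∈ Ioo (a - κ) (a + κ), 0 < deriv g t) ∧
      ∀ y ∈ e.target, ContDiffAt ℝ ∞ e.symm y := by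
  have hga' : ContDiffAt ℝ ∞ g a := hg a ⟨by linarith, by linarith⟩
  -- positive derivative near `a`
  obtain ⟨κ₁, hκ₁, hsub₁⟩ : ∃ κ₁ > 0, Ioo (a - κ₁) (a + κ₁) ⊆ {t | 0 < deriv g t} := by
    obtain ⟨r, hr, h⟩ := Metric.mem_nhds_iff.1 (eventually_deriv_pos hga' hga)
    exact ⟨r, hr, by rwa [Real.ball_eq_Ioo] at h⟩
  -- the local inverse at `a`
  have hd : HasDerivAt g (deriv g a) a := (hga'.differentiableAt (by simp)).hasDerivAt
  set e₀ := hga'.toOpenPartialHomeomorph g (hd.hasFDerivAt_equiv hga.ne') (by simp) with he₀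
  have he₀g : ⇑e₀ = g := hga'.toOpenPartialHomeomorph_coe _ _
  have ha₀ : a ∈ e₀.source := hga'.mem_toOpenPartialHomeomorph_source _ _
  obtain ⟨κ₂, hκ₂, hsub₂⟩ : ∃ κ₂ > 0, Ioo (a - κ₂) (a + κ₂) ⊆ e₀.source := by
    obtain ⟨r, hr, h⟩ := Metric.mem_nhds_iff.1 (e₀.open_source.mem_nhds ha₀)
    exact ⟨r, hr, by rwa [Real.ball_eq_Ioo] at h⟩
  set κ : ℝ := min κ₀ (min κ₁ κ₂) with hκ
  have hκpos : 0 < κ := lt_min hκ₀ (lt_min hκ₁ hκ₂)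
  have hI₀ : Ioo (a - κ) (a + κ) ⊆ Ioo (a - κ₀) (a + κ₀) :=
    Ioo_subset_Ioo (by linarith [min_le_left κ₀ (min κ₁ κ₂)]) (by linarith [min_le_left κ₀ (min κ₁ κ₂)])
  have hI₁ : Ioo (a - κ) (a + κ) ⊆ Ioo (a - κ₁) (a + κ₁) :=
    Ioo_subset_Ioo (by linarith [min_le_right κ₀ (min κ₁ κ₂), min_le_left κ₁ κ₂])
      (by linarith [min_le_right κ₀ (min κ₁ κ₂), min_le_left κ₁ κ₂])
  have hI₂ : Ioo (a - κ) (a + κ) ⊆ e₀.source := (Ioo_subset_Ioo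
    (by linarith [min_le_right κ₀ (min κ₁ κ₂), min_le_right κ₁ κ₂])
    (by linarith [min_le_right κ₀ (min κ₁ κ₂), min_le_right κ₁ κ₂])).trans hsub₂
  have hpos : ∀ t ∈ Ioo (a - κ) (a + κ), 0 < deriv g t := fun t ht ↦ hsub₁ (hI₁ ht)
  have hsmooth : ∀ t ∈ Ioo (a - κ) (a + κ), ContDiffAt ℝ ∞ g t := fun t ht ↦ hg t (hI₀ ht)
  set e := e₀.restrOpen (Ioo (a - κ) (a + κ)) isOpen_Ioo with he
  have heg : ⇑e = g := he₀g
  have hsrc : e.source = Ioo (a - κ) (a + κ) := by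
    rw [he, OpenPartialHomeomorph.restrOpen_source, inter_eq_right.2 hI₂]
  have hmono : StrictMonoOn g (Ioo (a - κ) (a + κ)) :=
    strictMonoOn_of_deriv_pos (convex_Ioo _ _)
      (fun t ht ↦ (hsmooth t ht).continuousAt.continuousWithinAt)
      (fun t ht ↦ hpos t (interior_subset ht))
  refine ⟨κ, ⟨hκpos, min_le_left _ _⟩, e, heg, hsrc, hmono, hpos, fun y hy ↦ ?_⟩
  have hys : e.symm y ∈ Ioo (a - κ) (a + κ) := hsrc ▸ e.map_target hy
  refine e.contDiffAt_symm_deriv (hpos _ hys).ne' hy ?_ ?_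
  · rw [heg]
    exact ((hsmooth _ hys).differentiableAt (by simp)).hasDerivAt
  · rw [heg]
    exact hsmooth _ hys

end LocalInverse


/-- **The planar track of a knot as a graph over `x₁`.** If the planar `x₁`-coordinate `g` of the
track of a knot `L` has positive derivative at `a` (the track lying in the image of the thickening
for parameters in `(a - κ₀, a + κ₀)`), then on some `(a - κ, a + κ)`, `κ ≤ κ₀`, `g` is a strictly
increasing open partial homeomorphism `e` onto an open set of heights, and the `x₀`-coordinate of
the track is a `C^∞` function `x₀ ∘ track ∘ e⁻¹` of the height there. [folklore] -/
theorem PatchThickening.exists_track_graph {β : 𝔼 2 → 𝕊 3} {δ₀ δ₁ : ℝ}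
    (T : PatchThickening β δ₀ δ₁) (L : Knot) {a κ₀ : ℝ} (hκ₀ : 0 < κ₀)
    (hmem : ∀ t ∈ Ioo (a - κ₀) (a + κ₀), L (circlePt t) ∈ range T.emb)
    (hpos : 0 < deriv (fun t ↦ T.planar (L (circlePt t)) 1) a) :
    ∃ κ ∈ Ioc 0 κ₀, ∃ e : OpenPartialHomeomorph ℝ ℝ,
      ⇑e = (fun t ↦ T.planar (L (circlePt t)) 1) ∧ e.source = Ioo (a - κ) (a + κ) ∧
      StrictMonoOn (fun t ↦ T.planar (L (circlePt t)) 1) (Ioo (a - κ) (a + κ)) ∧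
      ∀ y ∈ e.target, ContDiffAt ℝ ∞ (fun y ↦ T.planar (L (circlePt (e.symm y))) 0) y := by
  obtain ⟨κ, hκ, e, heg, hsrc, hmono, -, hsymm⟩ := exists_openPartialHomeomorph_of_deriv_pos hκ₀
    (fun t ht ↦ T.contDiffAt_planar_track_apply L (hmem t ht) 1) hpos
  refine ⟨κ, hκ, e, heg, hsrc, hmono, fun y hy ↦ ?_⟩
  have hys : e.symm y ∈ Ioo (a - κ) (a + κ) := hsrc ▸ e.map_target hy
  have hys₀ : e.symm y ∈ Ioo (a - κ₀) (a + κ₀) :=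
    Ioo_subset_Ioo (by linarith [hκ.2]) (by linarith [hκ.2]) hys
  exact (T.contDiffAt_planar_track_apply L (hmem _ hys₀) 0).comp y (hsymm y hy)

namespace BandData

variable {K₁ K₂ K : Knot} {avoid : Set (𝕊 3)} (b : BandData K₁ K₂ K avoid)
variable {δ₀ δ₁ : ℝ} (T : PatchThickening b.band δ₀ δ₁)

/-- A smooth knot track stays in the image of the thickening on an interval around a parameter
over it. [folklore] -/
theorem _root_.Literature.Topology.FourManifolds.PatchThickening.exists_Ioo_subset_track_mem
    {β : 𝔼 2 → 𝕊 3} {δ₀ δ₁ : ℝ} (T : PatchThickening β δ₀ δ₁) (L : Knot) {a : ℝ}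
    (ha : L (circlePt a) ∈ range T.emb) :
    ∃ κ > 0, ∀ t ∈ Ioo (a - κ) (a + κ), L (circlePt t) ∈ range T.emb := by
  obtain ⟨r, hr, h⟩ := Metric.mem_nhds_iff.1
    (T.eventually_mem_range_emb (L.continuous.comp continuous_circlePt) ha)
  exact ⟨r, hr, fun t ht ↦ h (by rwa [Real.ball_eq_Ioo])⟩

/-- **The lower arc near `p` is the graph of a function flat at `-δ` — the difference trick.**
For a lift `φ` of the lower arc there are `ε > 0` and functions `F`, `d`, `C^∞` on
`(-δ - ε, -δ + ε)`, such that: `d = 0` to the left of `-δ` and `d = F` to the right of `-δ`,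
`F (-δ) = 0`, the planar track of `K` just after `φ 0` is the graph `x₀ = F (x₁)` over heights in
`[-δ, -δ + ε)`, and every such height is attained on `[φ 0, φ 1]`. Here `F = x₀ ∘ track_K ∘ η⁻¹`
and `d = F - F₁` with `F₁ = x₀ ∘ track_{K₁} ∘ η₁⁻¹` the analogous graph function of `K₁`
(`η`, `η₁` the `x₁`-coordinates of the two tracks, local diffeomorphisms by
`deriv_planar_track_one_pos`, `deriv_planar_left_track_one_pos`): to the left of `-δ` both tracks
run on the same arc `C⁻` (`eventually_exists_apply_eq_left`), so `F = F₁`; to the right, `K₁` runs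
up the edge line `x₀ = 0`, so `F₁ = 0`. In particular the zero extension of `F|[-δ, -δ + ε)` to
the left is `C^∞`: the lower arc leaves `p` infinitely tangent to the edge line. [folklore] -/
theorem exists_graphFun_left (hδ₁ : b.δ < δ₁) (hdisj : Disjoint (range K₁) (range K₂))
    {φ : ℝ → ℝ} (hφ : Continuous φ) (hφm : StrictMonoOn φ (Icc 0 1))
    (hφℓ : ∀ s ∈ Icc (0 : ℝ) 1, K (circlePt (φ s)) = b.lowerCurve s) :
    ∃ ε > 0, ∃ F d : ℝ → ℝ,
      (∀ y ∈ Ioo (-b.δ - ε) (-b.δ + ε), ContDiffAt ℝ ∞ F y ∧ ContDiffAt ℝ ∞ d y) ∧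
      (∀ y ∈ Ioo (-b.δ - ε) (-b.δ + ε), y ≤ -b.δ → d y = 0) ∧
      (∀ y ∈ Ioo (-b.δ - ε) (-b.δ + ε), -b.δ ≤ y → d y = F y) ∧
      F (-b.δ) = 0 ∧
      (∃ κ > 0, ∀ t ∈ Ico (φ 0) (φ 0 + κ), T.planar (K (circlePt t)) 1 ∈ Ico (-b.δ) (-b.δ + ε) ∧
        T.planar (K (circlePt t)) 0 = F (T.planar (K (circlePt t)) 1)) ∧
      (∀ y ∈ Ico (-b.δ) (-b.δ + ε), ∃ t ∈ Icc (φ 0) (φ 1),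
        T.planar (K (circlePt t)) 1 = y ∧ T.planar (K (circlePt t)) 0 = F y) := by
  have hδ := b.δ_pos
  obtain ⟨χ, hχ, hχm, hχe⟩ := b.exists_lift_leftEdge
  have hcl := b.injOn_band_closedSquare T hδ₁
  have hp : K (circlePt (φ 0)) = b.band (pt2 0 (-b.δ)) := by
    rw [hφℓ 0 (left_mem_Icc.2 zero_le_one), lowerCurve_zero]
  have hp₁ : K₁ (circlePt (χ 0)) = b.band (pt2 0 (-b.δ)) := by
    rw [hχe 0 (left_mem_Icc.2 zero_le_one), leftEdge_zero]
  have hmem : K (circlePt (φ 0)) ∈ range T.emb := hp ▸ b.band_lowerLeft_mem_range_emb T hδ₁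
  have hmem₁ : K₁ (circlePt (χ 0)) ∈ range T.emb := hp₁ ▸ b.band_lowerLeft_mem_range_emb T hδ₁
  have hφ01 : φ 0 < φ 1 := hφm (left_mem_Icc.2 zero_le_one) (right_mem_Icc.2 zero_le_one) zero_lt_one
  have hχ01 : χ 0 < χ 1 := hχm (left_mem_Icc.2 zero_le_one) (right_mem_Icc.2 zero_le_one) zero_lt_one
  -- the two tracks as graphs over the height `x₁`
  obtain ⟨κ₀, hκ₀, hκ₀sub⟩ := T.exists_Ioo_subset_track_mem K hmem
  obtain ⟨κ₀₁, hκ₀₁, hκ₀₁sub⟩ := T.exists_Ioo_subset_track_mem K₁ hmem₁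
  obtain ⟨κ, hκI, e, heg, hsrc, hmono, hsm⟩ := T.exists_track_graph K (a := φ 0)
    (κ₀ := min κ₀ (φ 1 - φ 0)) (lt_min hκ₀ (by linarith))
    (fun t ht ↦ hκ₀sub t (Ioo_subset_Ioo (by linarith [min_le_left κ₀ (φ 1 - φ 0)])
      (by linarith [min_le_left κ₀ (φ 1 - φ 0)]) ht))
    (b.deriv_planar_track_one_pos T hδ₁ hdisj hφ hφm hφℓ)
  obtain ⟨κ₁, hκ₁I, e₁, he₁g, hsrc₁, hmono₁, hsm₁⟩ := T.exists_track_graph K₁ (a := χ 0)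
    (κ₀ := min κ₀₁ (χ 1 - χ 0)) (lt_min hκ₀₁ (by linarith))
    (fun t ht ↦ hκ₀₁sub t (Ioo_subset_Ioo (by linarith [min_le_left κ₀₁ (χ 1 - χ 0)])
      (by linarith [min_le_left κ₀₁ (χ 1 - χ 0)]) ht))
    (b.deriv_planar_left_track_one_pos T hδ₁ hχ hχm hχe)
  have hκ1 : κ ≤ φ 1 - φ 0 := hκI.2.trans (min_le_right _ _)
  have hκ₁1 : κ₁ ≤ χ 1 - χ 0 := hκ₁I.2.trans (min_le_right _ _)
  -- notation
  set g : ℝ → ℝ := fun t ↦ T.planar (K (circlePt t)) 1 with hg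
  set ξ : ℝ → ℝ := fun t ↦ T.planar (K (circlePt t)) 0 with hξ
  set g₁ : ℝ → ℝ := fun t ↦ T.planar (K₁ (circlePt t)) 1 with hg₁
  set ξ₁ : ℝ → ℝ := fun t ↦ T.planar (K₁ (circlePt t)) 0 with hξ₁
  set F : ℝ → ℝ := fun y ↦ ξ (e.symm y) with hF
  set F₁ : ℝ → ℝ := fun y ↦ ξ₁ (e₁.symm y) with hF₁
  -- values at the attaching point
  have hgφ : g (φ 0) = -b.δ := by
    simp only [hg]; rw [hp, b.planar_band_lowerLeft T hδ₁, pt2_apply_one]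
  have hξφ : ξ (φ 0) = 0 := by
    simp only [hξ]; rw [hp, b.planar_band_lowerLeft T hδ₁, pt2_apply_zero]
  have hg₁χ : g₁ (χ 0) = -b.δ := by
    simp only [hg₁]; rw [hp₁, b.planar_band_lowerLeft T hδ₁, pt2_apply_one]
  have hφsrc : φ 0 ∈ e.source := by rw [hsrc]; exact ⟨by linarith [hκI.1], by linarith [hκI.1]⟩
  have hχsrc : χ 0 ∈ e₁.source := by rw [hsrc₁]; exact ⟨by linarith [hκ₁I.1], by linarith [hκ₁I.1]⟩
  have htgt : -b.δ ∈ e.target := by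
    have := e.map_source hφsrc; rwa [heg, hgφ] at this
  have htgt₁ : -b.δ ∈ e₁.target := by
    have := e₁.map_source hχsrc; rwa [he₁g, hg₁χ] at this
  have hesymm : e.symm (-b.δ) = φ 0 := by
    have := e.left_inv hφsrc; rwa [heg, hgφ] at this
  have he₁symm : e₁.symm (-b.δ) = χ 0 := by
    have := e₁.left_inv hχsrc; rwa [he₁g, hg₁χ] at this
  -- inverse relations
  have hginv : ∀ y ∈ e.target, g (e.symm y) = y := fun y hy ↦ by
    have := e.right_inv hy; rwa [heg] at this
  have hg₁inv : ∀ y ∈ e₁.target, g₁ (e₁.symm y) = y := fun y hy ↦ by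
    have := e₁.right_inv hy; rwa [he₁g] at this
  have hsymm_mem : ∀ y ∈ e.target, e.symm y ∈ Ioo (φ 0 - κ) (φ 0 + κ) := fun y hy ↦
    hsrc ▸ e.map_target hy
  have hsymm₁_mem : ∀ y ∈ e₁.target, e₁.symm y ∈ Ioo (χ 0 - κ₁) (χ 0 + κ₁) := fun y hy ↦
    hsrc₁ ▸ e₁.map_target hy
  -- the shared arc `C⁻`, pointwise
  obtain ⟨l₂, hl₂, hl₂sub⟩ := mem_nhdsLT_iff_exists_Ioo_subset.1
    (b.eventually_exists_apply_eq_left hcl hdisj hφ hφm hφℓ hχ hχm hχe hκ₁I.1)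
  have hl₂' : l₂ < φ 0 := hl₂
  -- a neighbourhood of the height `-δ` on which everything is defined
  have hNo : IsOpen ((e.target ∩ e.symm ⁻¹' Ioi l₂) ∩ e₁.target) :=
    (e.continuousOn_symm.isOpen_inter_preimage e.open_target isOpen_Ioi).inter e₁.open_target
  have hNmem : -b.δ ∈ (e.target ∩ e.symm ⁻¹' Ioi l₂) ∩ e₁.target :=
    ⟨⟨htgt, by rw [mem_preimage, hesymm]; exact hl₂'⟩, htgt₁⟩
  obtain ⟨ε, hε, hεsub⟩ : ∃ ε > 0, Ioo (-b.δ - ε) (-b.δ + ε) ⊆ (e.target ∩ e.symm ⁻¹' Ioi l₂) ∩ e₁.target := by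
    obtain ⟨r, hr, h⟩ := Metric.mem_nhds_iff.1 (hNo.mem_nhds hNmem)
    exact ⟨r, hr, by rwa [Real.ball_eq_Ioo] at h⟩
  -- Claim A: to the left of `-δ` the two graph functions agree (both tracks run on `C⁻`)
  have hA : ∀ y ∈ Ioo (-b.δ - ε) (-b.δ + ε), y ≤ -b.δ → F y = F₁ y := by
    intro y hy hle
    obtain ⟨⟨hyt, hyl⟩, hyt₁⟩ := hεsub hy
    rcases hle.eq_or_lt with rfl | hlt
    · simp only [hF, hF₁]
      rw [hesymm, he₁symm, hξφ]
      exact (b.planar_left_track_zero T hδ₁ hχ hχe (left_mem_Icc.2 hχ01.le)).symm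
    · set t := e.symm y with ht
      have htsrc : t ∈ Ioo (φ 0 - κ) (φ 0 + κ) := hsymm_mem y hyt
      have hgt : g t = y := hginv y hyt
      have htφ : t < φ 0 := by
        rw [← hmono.lt_iff_lt htsrc (hsrc ▸ hφsrc), hgt, hgφ]; exact hlt
      have htl : l₂ < t := hyl
      obtain ⟨u, hu, hKu⟩ : ∃ u ∈ Ioo (χ 0 - κ₁) (χ 0), K (circlePt t) = K₁ (circlePt u) :=
        hl₂sub ⟨htl, htφ⟩
      have husrc : u ∈ e₁.source := by rw [hsrc₁]; exact ⟨hu.1, by linarith [hu.2, hκ₁I.1]⟩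
      have hgu : g₁ u = y := by
        rw [← hgt]; simp only [hg, hg₁]; rw [hKu]
      have hsymmu : e₁.symm y = u := by
        have := e₁.left_inv husrc; rwa [he₁g, hgu] at this
      simp only [hF, hF₁]
      rw [hsymmu, ← ht]
      simp only [hξ, hξ₁]
      rw [hKu]
  -- Claim B: to the right of `-δ` the graph function of `K₁` vanishes (edge line `x₀ = 0`)
  have hB : ∀ y ∈ Ioo (-b.δ - ε) (-b.δ + ε), -b.δ ≤ y → F₁ y = 0 := by
    intro y hy hge
    obtain ⟨-, hyt₁⟩ := hεsub hy
    set u := e₁.symm y with hu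
    have husrc : u ∈ Ioo (χ 0 - κ₁) (χ 0 + κ₁) := hsymm₁_mem y hyt₁
    have hgu : g₁ u = y := hg₁inv y hyt₁
    have hχu : χ 0 ≤ u := by
      rw [← hmono₁.le_iff_le (hsrc₁ ▸ hχsrc) husrc, hgu, hg₁χ]; exact hge
    have hu1 : u ≤ χ 1 := by linarith [husrc.2]
    simp only [hF₁]
    exact b.planar_left_track_zero T hδ₁ hχ hχe ⟨hχu, hu1⟩
  -- Claim C: smoothness
  have hC : ∀ y ∈ Ioo (-b.δ - ε) (-b.δ + ε), ContDiffAt ℝ ∞ F y ∧ ContDiffAt ℝ ∞ F₁ y := by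
    intro y hy
    obtain ⟨⟨hyt, -⟩, hyt₁⟩ := hεsub hy
    exact ⟨hsm y hyt, hsm₁ y hyt₁⟩
  refine ⟨ε, hε, F, fun y ↦ F y - F₁ y, fun y hy ↦ ⟨(hC y hy).1, (hC y hy).1.sub (hC y hy).2⟩,
    fun y hy hle ↦ sub_eq_zero.2 (hA y hy hle),
    fun y hy hge ↦ by show F y - F₁ y = F y; rw [hB y hy hge, sub_zero],
    ?_, ?_, ?_⟩
  · simp only [hF]; rw [hesymm]; exact hξφ
  · -- the track just after `φ 0` is the graph of `F`
    have hgc : ContinuousAt g (φ 0) := (T.contDiffAt_planar_track_apply K hmem 1).continuousAt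
    obtain ⟨κ', hκ', hκ'sub⟩ : ∃ κ' > 0, Ioo (φ 0 - κ') (φ 0 + κ') ⊆ g ⁻¹' Iio (-b.δ + ε) := by
      obtain ⟨r, hr, h⟩ := Metric.mem_nhds_iff.1 (hgc.preimage_mem_nhds
        (isOpen_Iio.mem_nhds (show g (φ 0) ∈ Iio (-b.δ + ε) by rw [hgφ]; exact by simp [hε])))
      exact ⟨r, hr, by rwa [Real.ball_eq_Ioo] at h⟩
    refine ⟨min κ κ', lt_min hκI.1 hκ', fun t ht ↦ ?_⟩
    have htsrc : t ∈ Ioo (φ 0 - κ) (φ 0 + κ) :=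
      ⟨by linarith [ht.1, hκI.1], lt_of_lt_of_le ht.2 (by linarith [min_le_left κ κ'])⟩
    have htκ' : t ∈ Ioo (φ 0 - κ') (φ 0 + κ') :=
      ⟨by linarith [ht.1], lt_of_lt_of_le ht.2 (by linarith [min_le_right κ κ'])⟩
    have hge : -b.δ ≤ g t := by
      rw [← hgφ, hmono.le_iff_le (hsrc ▸ hφsrc) htsrc]; exact ht.1
    have hlt : g t < -b.δ + ε := hκ'sub htκ'
    refine ⟨⟨hge, hlt⟩, ?_⟩
    show ξ t = F (g t)
    simp only [hF]
    have : e.symm (g t) = t := by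
      have h := e.left_inv (show t ∈ e.source by rw [hsrc]; exact htsrc); rwa [heg] at h
    rw [this]
  · -- every height in `[-δ, -δ + ε)` is attained on `[φ 0, φ 1]`
    intro y hy
    have hy' : y ∈ Ioo (-b.δ - ε) (-b.δ + ε) := ⟨by linarith [hy.1], hy.2⟩
    obtain ⟨⟨hyt, -⟩, -⟩ := hεsub hy'
    set t := e.symm y with ht
    have htsrc : t ∈ Ioo (φ 0 - κ) (φ 0 + κ) := hsymm_mem y hyt
    have hgt : g t = y := hginv y hyt
    have hφt : φ 0 ≤ t := by
      rw [← hmono.le_iff_le (hsrc ▸ hφsrc) htsrc, hgt, hgφ]; exact hy.1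
    have ht1 : t ≤ φ 1 := by linarith [htsrc.2]
    exact ⟨t, ⟨hφt, ht1⟩, hgt, rfl⟩

/-! ### The flat graph germ of the lower arc at `A = (0, -δ)` -/

/-- A smooth cutoff in the height: `1` up to `-δ + ε/4`, `0` from `-δ + ε/2` on
(`Real.smoothTransition`). [folklore] -/
def heightCutoff (δ ε : ℝ) (y : ℝ) : ℝ := Real.smoothTransition ((-δ + ε / 2 - y) / (ε / 4))

/-- The height cutoff is smooth. [folklore] -/
theorem contDiff_heightCutoff (δ ε : ℝ) : ContDiff ℝ ∞ (heightCutoff δ ε) :=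
  Real.smoothTransition.contDiff.comp ((contDiff_const.sub contDiff_id).div_const _)

/-- The height cutoff is `1` up to `-δ + ε/4`. [folklore] -/
theorem heightCutoff_eq_one {δ ε y : ℝ} (hε : 0 < ε) (hy : y ≤ -δ + ε / 4) : heightCutoff δ ε y = 1 := by
  apply Real.smoothTransition.one_of_one_le
  rw [le_div_iff₀ (by positivity)]
  linarith

/-- The height cutoff vanishes from `-δ + ε/2` on. [folklore] -/
theorem heightCutoff_eq_zero {δ ε y : ℝ} (hε : 0 < ε) (hy : -δ + ε / 2 ≤ y) : heightCutoff δ ε y = 0 := by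
  apply Real.smoothTransition.zero_of_nonpos
  exact div_nonpos_of_nonpos_of_nonneg (by linarith) (by positivity)

/-- The planar coordinate of the track of `K` at a lifted parameter of the lower arc is the lower
arc. [folklore] -/
theorem planar_track_lift_lowerArc (hδ₁ : b.δ < δ₁) {φ : ℝ → ℝ}
    (hφℓ : ∀ s ∈ Icc (0 : ℝ) 1, K (circlePt (φ s)) = b.lowerCurve s) {s : ℝ} (hs : s ∈ Icc (0 : ℝ) 1) :
    T.planar (K (circlePt (φ s))) = b.lowerArc s := by
  rw [hφℓ s hs]
  exact T.planar_apply_patch (b.closedSquare_subset_range_param T hδ₁ (b.lowerArc_mem_closedSquare hs))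

/-- The lower arc avoids the corner `(0, -δ)` except at its start. [folklore] -/
theorem lowerArc_ne_lowerLeft {s : ℝ} (hs : s ∈ Ioc (0 : ℝ) 1) : b.lowerArc s ≠ pt2 0 (-b.δ) := by
  intro h
  rcases hs.2.eq_or_lt with rfl | hs1
  · rw [b.lowerArc_one] at h
    have h0 : (pt2 1 (-b.δ) : 𝔼 2) 0 = (pt2 0 (-b.δ) : 𝔼 2) 0 := by rw [h]
    rw [pt2_apply_zero, pt2_apply_zero] at h0
    exact one_ne_zero h0
  · have h1 := ((b.lowerArc_mem s ⟨hs.1, hs1⟩).1 1).1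
    rw [h, pt2_apply_one] at h1
    exact lt_irrefl _ h1

include T in
/-- **The lower arc near `A = (0, -δ)` is the graph, over the height `x₁ ≥ -δ`, of a `C^∞` function
vanishing identically to the left of `-δ`** (for band data thickened over a wider collar, the two
summands disjoint). With `ε`, `F`, `d` from `exists_graphFun_left`, the function is the zero
extension `f = 𝟙_{x₁ > -δ} · c · F = 𝟙_{x₁ > -δ} · c · d` (`c` a cutoff in the height), smooth
across `-δ` because `d` is smooth there and vanishes to the left; the graph description of the
track of `K` after `φ 0` and a compactness argument along the rest of the arc give the set
equality near `A`. This is the local input at the attaching point `A` for the planar isotopy of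
the two arc systems. [folklore] -/
theorem exists_flat_graph_lowerArc_left (hδ₁ : b.δ < δ₁) (hdisj : Disjoint (range K₁) (range K₂)) :
    ∃ f : ℝ → ℝ, ContDiff ℝ ∞ f ∧ (∀ y ≤ -b.δ, f y = 0) ∧ ∃ ε > 0, ∀ x : 𝔼 2,
      dist x (pt2 0 (-b.δ)) < ε → (x ∈ b.lowerArc '' Icc 0 1 ↔ -b.δ ≤ x 1 ∧ x 0 = f (x 1)) := by
  have hδ := b.δ_pos
  obtain ⟨φ, hφ, hφm, hφℓ⟩ := b.exists_lift_lowerCurve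
  obtain ⟨ε, hε, F, d, hsmooth, hd0, hdF, hF0, ⟨κ, hκ, htrack⟩, hattain⟩ :=
    b.exists_graphFun_left T hδ₁ hdisj hφ hφm hφℓ
  set c : ℝ → ℝ := heightCutoff b.δ ε with hc
  set f : ℝ → ℝ := fun y ↦ if y ≤ -b.δ then 0 else c y * F y with hf
  have hfF : ∀ y ∈ Ico (-b.δ) (-b.δ + ε / 4), f y = F y := by
    intro y hy
    rcases hy.1.eq_or_lt with h | hlt
    · rw [← h, hF0]; simp [hf]
    · simp only [hf]
      rw [if_neg (not_le.2 hlt), hc, heightCutoff_eq_one hε hy.2.le, one_mul]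
  refine ⟨f, ?_, fun y hy ↦ if_pos hy, ?_⟩
  · -- smoothness of the zero extension
    rw [contDiff_iff_contDiffAt]
    intro y
    rcases lt_trichotomy y (-b.δ) with hlt | rfl | hgt
    · refine (contDiffAt_const (c := (0 : ℝ))).congr_of_eventuallyEq ?_
      filter_upwards [isOpen_Iio.mem_nhds hlt] with y' hy'
      exact if_pos (le_of_lt hy')
    · have hsm : ContDiffAt ℝ ∞ (fun y ↦ c y * d y) (-b.δ) :=
        (contDiff_heightCutoff b.δ ε).contDiffAt.mul (hsmooth _ ⟨by linarith, by linarith⟩).2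
      refine hsm.congr_of_eventuallyEq ?_
      filter_upwards [Ioo_mem_nhds (show -b.δ - ε < -b.δ by linarith)
        (show -b.δ < -b.δ + ε by linarith)] with y' hy'
      by_cases hle : y' ≤ -b.δ
      · simp only [hf]
        rw [if_pos hle, hd0 y' hy' hle, mul_zero]
      · simp only [hf]
        rw [if_neg hle, hdF y' hy' (le_of_lt (not_le.1 hle))]
    · have hev : f =ᶠ[𝓝 y] fun y ↦ c y * F y := by
        filter_upwards [isOpen_Ioi.mem_nhds hgt] with y' hy'
        simp only [hf]
        rw [if_neg (not_le.2 hy')]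
      by_cases hyε : y < -b.δ + ε
      · exact ((contDiff_heightCutoff b.δ ε).contDiffAt.mul (hsmooth y ⟨by linarith, hyε⟩).1).congr_of_eventuallyEq hev
      · refine (contDiffAt_const (c := (0 : ℝ))).congr_of_eventuallyEq ?_
        filter_upwards [hev, isOpen_Ioi.mem_nhds (show -b.δ + ε / 2 < y by linarith [not_lt.1 hyε])]
          with y' h1 h2
        rw [h1, hc, heightCutoff_eq_zero hε (le_of_lt h2), zero_mul]
  · -- the set equality near `A`
    -- parameters `s < s₀` have lifted parameter in `[φ 0, φ 0 + κ)`
    obtain ⟨s₀, hs₀, hs₀1, hs₀κ⟩ : ∃ s₀ > 0, s₀ ≤ 1 ∧ ∀ s ∈ Ico (0 : ℝ) s₀, φ s < φ 0 + κ := by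
      obtain ⟨r, hr, h⟩ := Metric.mem_nhds_iff.1 (hφ.continuousAt.preimage_mem_nhds
        (isOpen_Iio.mem_nhds (show φ 0 ∈ Iio (φ 0 + κ) by simp [hκ])))
      refine ⟨min r 1, lt_min hr one_pos, min_le_right _ _, fun s hs ↦ h ?_⟩
      rw [mem_ball, Real.dist_eq, abs_lt]
      exact ⟨by linarith [hs.1], by linarith [hs.2, min_le_left r 1]⟩
    -- the rest of the arc stays at positive distance from `A`
    obtain ⟨d₀, hd₀, hfar⟩ : ∃ d₀ > 0, ∀ s ∈ Icc s₀ 1, d₀ ≤ dist (b.lowerArc s) (pt2 0 (-b.δ)) := by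
      obtain ⟨s₁, hs₁, hmin⟩ := (isCompact_Icc (a := s₀) (b := 1)).exists_isMinOn
        (nonempty_Icc.2 hs₀1) ((b.contDiff_lowerArc.continuous.dist continuous_const).continuousOn)
      refine ⟨dist (b.lowerArc s₁) (pt2 0 (-b.δ)), dist_pos.2 (b.lowerArc_ne_lowerLeft ⟨hs₀.trans_le hs₁.1, hs₁.2⟩),
        fun s hs ↦ hmin hs⟩
    refine ⟨min (ε / 4) d₀, lt_min (by positivity) hd₀, fun x hx ↦ ⟨?_, ?_⟩⟩
    · -- points of the arc near `A`
      rintro ⟨s, hs, rfl⟩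
      have hss₀ : s < s₀ := by
        by_contra h
        have := hfar s ⟨not_lt.1 h, hs.2⟩
        linarith [min_le_right (ε / 4) d₀]
      have ht : φ s ∈ Ico (φ 0) (φ 0 + κ) :=
        ⟨hφm.monotoneOn (left_mem_Icc.2 zero_le_one) hs hs.1, hs₀κ s ⟨hs.1, hss₀⟩⟩
      obtain ⟨hg, hξ⟩ := htrack (φ s) ht
      rw [b.planar_track_lift_lowerArc T hδ₁ hφℓ hs] at hg hξ
      refine ⟨hg.1, ?_⟩
      rw [hξ, hfF _ ⟨hg.1, ?_⟩]
      have h1 : |b.lowerArc s 1 - (-b.δ)| ≤ dist (b.lowerArc s) (pt2 0 (-b.δ)) := by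
        have := PiLp.dist_apply_le (b.lowerArc s) (pt2 0 (-b.δ)) 1
        rwa [pt2_apply_one, Real.dist_eq] at this
      have h2 : dist (b.lowerArc s) (pt2 0 (-b.δ)) < ε / 4 := lt_of_lt_of_le hx (min_le_left _ _)
      have h3 := (abs_lt.1 (lt_of_le_of_lt h1 h2)).2
      linarith
    · -- points of the graph near `A` are on the arc
      rintro ⟨hx1, hx0⟩
      have h1 : |x 1 - (-b.δ)| ≤ dist x (pt2 0 (-b.δ)) := by
        have := PiLp.dist_apply_le x (pt2 0 (-b.δ)) 1
        rwa [pt2_apply_one, Real.dist_eq] at this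
      have h2 : dist x (pt2 0 (-b.δ)) < ε / 4 := lt_of_lt_of_le hx (min_le_left _ _)
      have h3 := (abs_lt.1 (lt_of_le_of_lt h1 h2)).2
      have hy : x 1 ∈ Ico (-b.δ) (-b.δ + ε) := ⟨hx1, by linarith⟩
      obtain ⟨t, ht, hgt, hξt⟩ := hattain (x 1) hy
      obtain ⟨s, hs, rfl⟩ := exists_eq_of_mem_Icc_lift hφ ht
      refine ⟨s, hs, ?_⟩
      rw [← b.planar_track_lift_lowerArc T hδ₁ hφℓ hs]
      ext i
      fin_cases i
      · show T.planar (K (circlePt (φ s))) 0 = x 0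
        rw [hξt, hx0, hfF _ ⟨hx1, by linarith⟩]
      · exact hgt

end BandData

end Literature.Topology.FourManifolds
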